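import Mathlib.Analysis.SpecialFunctions.Pow.Real
import Mathlib.Analysis.SpecialFunctions.Pow.Asymptotics
import Mathlib.Analysis.SpecialFunctions.Log.Basic
import Mathlib.Algebra.Order.BigOperators.Group.Finset
import Mathlib.Data.Nat.Log
import Mathlib.Order.Filter.AtTopBot.Basic
import Literature.NumberTheory.Transcendental.RoySmallValueEstimatesEndgameProofs
import HarnessLib

/-!
# Small value estimates at rational translates (Nguyen–Roy 2016) — proofs, VIII: the assembly of §6

Eighth proofs file towards `Literature.NumberTheory.Transcendental.nguyenRoy2016_thm_1` (Nguyen–Roy,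
*A small value estimate in dimension two involving translations by rational points*, IJNT 12 (2016)
= arXiv:1412.5163, Theorem 1). Everything here is PROVED; there are no named facts. This file
formalises the LAST part of the printed proof — §5 from Proposition 17 on and the whole of §6 —
once and for all, in an abstract form that isolates it from the height machinery of §§4–5
(Chow forms, heights of `ℚ`-subvarieties, [R2012] Thm. 5.6 and Props. 2.3, 6.1, 6.2), which is
not yet in the tree.

## Design

The printed §6 consumes only the following data and estimates, which we bundle as a hypothesis
structure `NguyenRoy.EndgameData σ β ν` (a `Type`-valued record: data + the properties §6 uses;
nothing is asserted, and every field cites the printed statement it abstracts):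

* the points of `ℙ²(ℂ)` with the projective distance of §2 (`0 ≤ dist ≤ 2`, symmetric, weak
  triangle inequality — here in the symmetric weakening `dist(a,c) ≤ 2(dist(a,b) + dist(b,c))`
  of the printed `dist(α,γ) ≤ 2 dist(α,β) + dist(β,γ)`), the translation `τ` (a `ℤ`-action) with
  **Lemma 5** (`dist(τⁱa, τⁱb) ≤ e^{c₁|i|} dist(a,b)`) and the points `γ_i = τⁱγ₀`;
* the zero-dimensional `ℚ`-subvarieties `Z` with their (finite, non-empty) sets of points
  (`deg Z = #pts Z`), heights `h(Z) ≥ 0` and translates `τⁱZ`, **Lemma 11**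
  (`h(τⁱZ) ≤ h(Z) + c₄|i| deg Z`), **Proposition 12** for one pair of DISTINCT points
  (`dist ≥ exp(−(c₁₂ deg deg* + deg h* + deg* h))`, printed `c₁₂ = 7`), and
  the positivity `dist(α, γ_i) > 0` for algebraic `α` — the standing hypothesis
  `(ξ, η) ∉ ℚ̄ × ℚ̄` of §6, which also makes all the printed `log dist` finite (the finiteness of
  the subvarieties of bounded degree and height, used in the first paragraph of §6, is NOT
  required: Proposition 12 and the finiteness of each `pts Z` replace it, see
  `eventually_lt_card_or_lt_ht`);
* the predicate `Z ⊆ W_D` — it only depends on the points of `Z`, and since `W_D` is defined over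
  `ℚ` a subvariety sharing a point with some `Z ⊆ W_D` lies in `W_D` (`isIn_of_mem`) — with
  **Proposition 14** (constants `A₁₄, B₁₄`, printed `2, 6`);
* the subvarieties `Z_D ⊆ W_D` of **Proposition 15** with the estimate of **Corollary 16**
  (constant `κ`, printed `1/30`; the closest point `γ_{ι(α)}`, `0 ≤ ι(α) < ⌊D^σ⌋`, is made explicit);
* for `Z ⊄ W_D`, the polynomial `P = Φʲ(P̃_D)`, `0 ≤ j < 2⌊D^σ⌋`, not vanishing on `Z`, through the
  two estimates §6 uses about `v(α) = |P(α)|` (`α` normalised): the mean lower bound of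
  [R2012, Prop. 2.3] (`∑ log v ≥ −c₇ D deg Z − D h(Z)`, printed `c₇ = 7 log 3`) and the pointwise
  upper bound (6.5) from **Lemma 6** and **Proposition 4**
  (`v(α) ≤ e^{−D^ν/2} + (D+2)³ e^{2D^β} dist(α, γ_k)` for `0 ≤ j + k < 4⌊D^σ⌋`).

From an `EndgameData` we then PROVE, following the printed argument step by step:

* `EndgameData.prop17` — **Proposition 17** (dyadic selection `dyadic_selection` of file VII applied
  to the closest indices of Corollary 16, then Lemmas 5 and 11), and its by-products
  `exists_close_point` (**Corollaries 18–19**);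
* `EndgameData.eventually_lt_card_or_lt_ht` — "`lim max{deg Z̃_D, h(Z̃_D)} = ∞`" (first paragraph
  of §6: Proposition 12 + positivity + Corollary 19);
* `EndgameData.dstar` — the auxiliary level `D*` of (6.1) (as `Nat.findGreatest`; it is `< D` by
  `bounds_self`, i.e. Proposition 14 applied to `Z_D` itself), with (6.2) (`ne_translates`) and
  (6.3) (`not_crit_dstar_succ` + `add_one_rpow_le_two_mul_rpow`);
* `EndgameData.case1_core` + `case1_eventually` — **Case 1**;
* `EndgameData.case2_core` + `case_two_exponent_contradiction'` — **Case 2** (the two sub-cases of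
  the printed argument; the final exponent bookkeeping is file VII's, here with generic constants
  `16B₁₄/(κA₁₄)`, `8/κ` in place of the printed `350`, `150`);
* `EndgameData.false_of_constraints` — **§6**: under the constraints (1) of Theorem 1
  (`1 ≤ σ < 2`, `β > σ + 1`, the two-case lower bound on `ν`) an `EndgameData σ β ν` cannot exist.

Consequently `nguyenRoy2016_thm_1` follows as soon as, assuming `(ξ, η) ∉ ℚ̄ × ℚ̄`, the concrete
objects of the paper are assembled into an `EndgameData σ β ν` — i.e. from Propositions 4, 14, the
full Proposition 12, Lemma 11, Corollary 16 and [R2012, Prop. 2.3] for zero-dimensional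
subvarieties (the remaining bricks; Lemmas 5, 6, 7, 13 and the diophantine core of Prop. 12 are
files I–VI). All constants are kept generic (fields `c₁, c₄, c₇, c₁₂, κ, A₁₄, B₁₄, D₀`), so that the
normalisation of heights chosen for the instantiation (the tree's `Nesterenko.iheight`) is free.

## References

* [NguyenRoy2016] N. A. V. Nguyen, D. Roy, IJNT 12 (2016) 1273–1293 = arXiv:1412.5163: §2
  (dist, `τ`, Lemmas 5, 6, Prop. 4), §4 (Lemma 11, Prop. 12), §5 (Prop. 14, Prop. 15, Cor. 16,
  Prop. 17, Cor. 18, Cor. 19), §6 (proof of Theorem 1: (6.1)–(6.6), Cases 1 and 2).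
* [Roy2013] D. Roy, Mathematika 59 (2013) = arXiv:1301.0663 ("[R2012]" in the paper), Prop. 2.3.
-/

noncomputable section

open Finset Filter

namespace Literature.NumberTheory.Transcendental

namespace NguyenRoy


/-- **The data entering §6 of Nguyen–Roy 2016** (hypothesis structure). For parameters `σ, β, ν`
it packages, in abstract form, the objects and the intermediate results of §§2–5 of the paper that
the final argument (§5 Prop. 17 – §6) consumes, so that this argument can be formalised once and
for all independently of the height machinery: points of `ℙ²(ℂ)` with the projective distance
(`dist`, §2) and the translation `τ` with its distortion constant `c₁` (Lemma 5); the points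
`γ_i = τ^i γ₀`; zero-dimensional `ℚ`-subvarieties `Z` (type `V`) with their finite sets of points
`pts Z` (`deg Z = #pts Z`), heights `ht Z ≥ 0`, translates `τV i Z` (Lemma 11, constant `c₄`), the
Liouville inequality of Proposition 12 (constant `c₁₂`, printed value `7`), and the positivity
`dist(α, γ_i) > 0` (the standing assumption `(ξ, η) ∉ ℚ̄ × ℚ̄` of §6); the predicate `IsIn Z D`
("`Z ⊆ W_D`") with Proposition 14
(constants `A₁₄, B₁₄`, printed values `2, 6`); the subvarieties `Z_D ⊆ W_D` of Proposition 15 with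
the estimate of Corollary 16 (constant `κ`, printed value `1/30`, the closest point `γ_{ι(α)}`,
`0 ≤ ι(α) < ⌊D^σ⌋`, made explicit); and, for `Z ⊄ W_D`, the polynomial `P = Φʲ(P̃_D)`
(`0 ≤ j < 2⌊D^σ⌋`) not vanishing on `Z` together with the two estimates §6 uses about its values
`v(α) = |P(α)|` at the normalised points of `Z`: the lower bound of [R2012, Prop. 2.3]
(`∑ log v(α) ≥ −c₇ D deg Z − D ht Z`, printed `c₇ = 7 log 3`) and the upper bound from Lemma 6 and
Proposition 4 (`v(α) ≤ e^{−D^ν/2} + (D+2)³ e^{2D^β} dist(α, γ_k)` whenever `0 ≤ j + k < 4⌊D^σ⌋`).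
Nothing is asserted: an `EndgameData` is a bundle of hypotheses, to be instantiated by the
concrete objects of the paper. [cite: NguyenRoy2016, §2 (dist, τ, Lemma 5, Lemma 6, Prop. 4), §4 (Lemma 11, Prop. 12), §5 (Prop. 14, Prop. 15, Cor. 16), §6] -/
structure EndgameData (σ β ν : ℝ) : Type 1 where
  /-- The points of `ℙ²(ℂ)`. -/
  Pt : Type
  /-- The zero-dimensional `ℚ`-subvarieties of `ℙ²(ℂ)`. -/
  V : Type
  /-- The projective distance (§2). -/
  dist : Pt → Pt → ℝ
  dist_nonneg : ∀ a b, 0 ≤ dist a b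
  dist_le_two : ∀ a b, dist a b ≤ 2
  dist_comm : ∀ a b, dist a b = dist b a
  /-- Weak triangle inequality (§2, in a symmetric weakening). -/
  dist_triangle : ∀ a b c, dist a c ≤ 2 * (dist a b + dist b c)
  /-- The translation `τ` and its iterates (§2). -/
  τ : ℤ → Pt → Pt
  τ_zero : ∀ a, τ 0 a = a
  τ_τ : ∀ i j a, τ i (τ j a) = τ (i + j) a
  /-- Lemma 5. -/
  c₁ : ℝ
  c₁_nonneg : 0 ≤ c₁
  dist_τ_le : ∀ (i : ℤ) (a b : Pt), dist (τ i a) (τ i b) ≤ Real.exp (c₁ * |(i : ℝ)|) * dist a b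
  /-- The points `γ_i = (1 : ξ + ir : η sⁱ)`, `τ(γ_i) = γ_{i+1}` (§2). -/
  γ : ℤ → Pt
  τ_γ : ∀ i j, τ i (γ j) = γ (i + j)
  /-- Points, heights and translates of zero-dimensional `ℚ`-subvarieties (§4). -/
  pts : V → Finset Pt
  pts_nonempty : ∀ Z, (pts Z).Nonempty
  ht : V → ℝ
  ht_nonneg : ∀ Z, 0 ≤ ht Z
  τV : ℤ → V → V
  τV_zero : ∀ Z, τV 0 Z = Z
  τV_τV : ∀ i j Z, τV i (τV j Z) = τV (i + j) Z
  mem_pts_τV : ∀ (i : ℤ) (Z : V) (b : Pt), b ∈ pts (τV i Z) ↔ ∃ a ∈ pts Z, τ i a = b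
  /-- Lemma 11. -/
  c₄ : ℝ
  c₄_nonneg : 0 ≤ c₄
  ht_τV_le : ∀ (i : ℤ) (Z : V), ht (τV i Z) ≤ ht Z + c₄ * |(i : ℝ)| * (pts Z).card
  /-- Proposition 12 (for one pair of distinct points). -/
  c₁₂ : ℝ
  c₁₂_nonneg : 0 ≤ c₁₂
  liouville : ∀ Z Z' : V, ∀ a ∈ pts Z, ∀ a' ∈ pts Z', a ≠ a' →
    Real.exp (-(c₁₂ * (pts Z).card * (pts Z').card + (pts Z).card * ht Z' + (pts Z').card * ht Z))
      ≤ dist a a'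
  /-- `(ξ, η) ∉ ℚ̄ × ℚ̄`: algebraic points are at positive distance from every `γ_i`. -/
  dist_γ_pos : ∀ (Z : V), ∀ a ∈ pts Z, ∀ i : ℤ, 0 < dist a (γ i)
  /-- `IsIn Z D`: `Z ⊆ W_D = 𝒵(Φⁱ(P̃_D); 0 ≤ i < 2⌊D^σ⌋)` (§5); `W_D` is defined over `ℚ`, so a
  subvariety sharing a point with a subvariety contained in `W_D` is contained in `W_D`. -/
  IsIn : V → ℕ → Prop
  isIn_of_mem : ∀ (D : ℕ) (Z Z' : V) (b : Pt), b ∈ pts Z → b ∈ pts Z' → IsIn Z D → IsIn Z' D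
  D₀ : ℕ
  /-- Proposition 14. -/
  A₁₄ : ℝ
  B₁₄ : ℝ
  one_le_A₁₄ : 1 ≤ A₁₄
  one_le_B₁₄ : 1 ≤ B₁₄
  prop14 : ∀ D : ℕ, D₀ ≤ D → ∀ Z : V, IsIn Z D → ∀ i : ℤ, |(i : ℝ)| < 3 * ⌊(D : ℝ) ^ σ⌋₊ →
    ((pts (τV i Z)).card : ℝ) ≤ A₁₄ * (D : ℝ) ^ (2 - σ) ∧
      ht (τV i Z) ≤ B₁₄ * (D : ℝ) ^ (1 + β - σ)
  /-- Proposition 15: the subvarieties `Z_D ⊆ W_D`. -/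
  Z : ℕ → V
  isIn_Z : ∀ D : ℕ, D₀ ≤ D → IsIn (Z D) D
  /-- Corollary 16. -/
  κ : ℝ
  κ_pos : 0 < κ
  cor16 : ∀ D : ℕ, D₀ ≤ D → ∃ ι : Pt → ℤ,
    (∀ a ∈ pts (Z D), 0 ≤ ι a ∧ ι a < (⌊(D : ℝ) ^ σ⌋₊ : ℕ)) ∧
    ∑ a ∈ pts (Z D), ((D : ℝ) ^ β + Real.log (dist a (γ (ι a)))) ≤
      -(κ * (D : ℝ) ^ (ν - β + σ - 2) * (2 * (D : ℝ) ^ β * (pts (Z D)).card + D * ht (Z D)))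
  /-- For `Z ⊄ W_D`: a polynomial `Φʲ(P̃_D)` not vanishing on `Z` ([R2012] Prop. 2.3, Lemma 6,
  Proposition 4). -/
  c₇ : ℝ
  c₇_nonneg : 0 ≤ c₇
  notIn : ∀ D : ℕ, D₀ ≤ D → ∀ Zv : V, ¬ IsIn Zv D → ∃ j : ℤ, 0 ≤ j ∧ j < 2 * (⌊(D : ℝ) ^ σ⌋₊ : ℕ) ∧
    ∃ v : Pt → ℝ, (∀ a ∈ pts Zv, 0 < v a) ∧
      -(c₇ * D * (pts Zv).card + D * ht Zv) ≤ ∑ a ∈ pts Zv, Real.log (v a) ∧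
      ∀ a ∈ pts Zv, ∀ k : ℤ, 0 ≤ j + k → j + k < 4 * (⌊(D : ℝ) ^ σ⌋₊ : ℕ) →
        v a ≤ Real.exp (-(D : ℝ) ^ ν / 2) +
          ((D : ℝ) + 2) ^ 3 * Real.exp (2 * (D : ℝ) ^ β) * dist a (γ k)

namespace EndgameData

variable {σ β ν : ℝ} (E : EndgameData σ β ν)

/-! ### Elementary consequences of the axioms -/

/-- `τ^{-i} ∘ τ^i = id`. [cite: NguyenRoy2016, §2] -/
theorem τ_neg_τ (i : ℤ) (a : E.Pt) : E.τ (-i) (E.τ i a) = a := by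
  rw [E.τ_τ, neg_add_cancel, E.τ_zero]

/-- `τ^i ∘ τ^{-i} = id`. [cite: NguyenRoy2016, §2] -/
theorem τ_τ_neg (i : ℤ) (a : E.Pt) : E.τ i (E.τ (-i) a) = a := by
  rw [E.τ_τ, add_neg_cancel, E.τ_zero]

/-- `τV^{-i} ∘ τV^i = id`. [cite: NguyenRoy2016, §4 (Lemma 11)] -/
theorem τV_neg_τV (i : ℤ) (Z : E.V) : E.τV (-i) (E.τV i Z) = Z := by
  rw [E.τV_τV, neg_add_cancel, E.τV_zero]

/-- `τV^i ∘ τV^{-i} = id`. [cite: NguyenRoy2016, §4 (Lemma 11)] -/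
theorem τV_τV_neg (i : ℤ) (Z : E.V) : E.τV i (E.τV (-i) Z) = Z := by
  rw [E.τV_τV, add_neg_cancel, E.τV_zero]

/-- `Z ↦ τV i Z` is injective. [cite: NguyenRoy2016, §4 (Lemma 11)] -/
theorem τV_injective (i : ℤ) : Function.Injective (E.τV i) := fun Z Z' h => by
  simpa [τV_neg_τV] using congrArg (E.τV (-i)) h

/-- `a ∈ pts Z ↦ τ i a ∈ pts (τV i Z)`. [cite: NguyenRoy2016, §4] -/
theorem τ_mem_pts_τV (i : ℤ) (Z : E.V) {a : E.Pt} (ha : a ∈ E.pts Z) :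
    E.τ i a ∈ E.pts (E.τV i Z) :=
  (E.mem_pts_τV i Z _).mpr ⟨a, ha, rfl⟩

/-- Sums over the points of a translate. [cite: NguyenRoy2016, §4] -/
theorem sum_pts_τV (i : ℤ) (Z : E.V) (f : E.Pt → ℝ) :
    ∑ b ∈ E.pts (E.τV i Z), f b = ∑ a ∈ E.pts Z, f (E.τ i a) := by
  refine Finset.sum_nbij' (fun b => E.τ (-i) b) (fun a => E.τ i a) ?_ ?_ ?_ ?_ ?_
  · intro b hb
    obtain ⟨a, ha, rfl⟩ := (E.mem_pts_τV i Z b).mp hb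
    rwa [τ_neg_τ]
  · intro a ha
    exact E.τ_mem_pts_τV i Z ha
  · intro b _
    exact E.τ_τ_neg i b
  · intro a _
    exact E.τ_neg_τ i a
  · intro b _
    rw [τ_τ_neg]

/-- Translates have the same degree. [cite: NguyenRoy2016, Lemma 11] -/
theorem card_pts_τV (i : ℤ) (Z : E.V) : (E.pts (E.τV i Z)).card = (E.pts Z).card := by
  have h := E.sum_pts_τV i Z (fun _ => (1 : ℝ))
  simp only [Finset.sum_const, nsmul_eq_mul, mul_one] at h
  exact_mod_cast h

/-- The degree is at least `1`. [cite: NguyenRoy2016, §4] -/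
theorem one_le_card (Z : E.V) : (1 : ℝ) ≤ (E.pts Z).card := by
  exact_mod_cast (E.pts_nonempty Z).card_pos

/-- Lemma 5, lower half: `dist(a, b) ≤ e^{c₁|i|} dist(τ i a, τ i b)`. [cite: NguyenRoy2016, Lemma 5] -/
theorem dist_le_exp_mul_dist_τ (i : ℤ) (a b : E.Pt) :
    E.dist a b ≤ Real.exp (E.c₁ * |(i : ℝ)|) * E.dist (E.τ i a) (E.τ i b) := by
  have h := E.dist_τ_le (-i) (E.τ i a) (E.τ i b)
  rw [τ_neg_τ, τ_neg_τ] at h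
  simpa [abs_neg] using h

/-! ### Thresholds -/

/-- For `a < b` and any `c`: `c D^a ≤ D^b` for all large integers `D`. [folklore] -/
theorem eventually_mul_rpow_le_rpow (c : ℝ) {a b : ℝ} (hab : a < b) :
    ∀ᶠ D : ℕ in atTop, c * (D : ℝ) ^ a ≤ (D : ℝ) ^ b := by
  have h1 : Tendsto (fun x : ℝ => x ^ (b - a)) atTop atTop := tendsto_rpow_atTop (by linarith)
  have h2 : Tendsto (fun D : ℕ => (D : ℝ) ^ (b - a)) atTop atTop :=
    h1.comp tendsto_natCast_atTop_atTop
  filter_upwards [h2.eventually_ge_atTop c, eventually_gt_atTop 0] with D hD hD0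
  have hDpos : (0 : ℝ) < D := by exact_mod_cast hD0
  calc c * (D : ℝ) ^ a ≤ (D : ℝ) ^ (b - a) * (D : ℝ) ^ a :=
        mul_le_mul_of_nonneg_right hD (Real.rpow_nonneg hDpos.le _)
    _ = (D : ℝ) ^ b := by rw [← Real.rpow_add hDpos, sub_add_cancel]

/-! ### Proposition 17: the good translate `Z̃_D = τ^{-m}(Z_D)` -/

/-- **Proposition 17** (Nguyen–Roy 2016), abstract form. For every large `D` there is
`0 ≤ m < ⌊D^σ⌋` such that the translate `Z̃_D = τ^{-m}(Z_D)` satisfies, for every integer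
`1 ≤ T* ≤ ⌊D^σ⌋`, `∑_{α ∈ Z̃_D} log dist(α, γ_{ι(α)}) ≤ −T* (κ/4) D^{ν−β−2} (D^β deg Z̃_D + D h(Z̃_D))`
for a choice of indices `|ι(α)| < T*` (i.e. with `dist(α, Γ(T*))`, `Γ(T*) = {γ_i ; |i| < T*}`, in
place of `dist(α, γ_{ι(α)})`; printed constant `κ/4 = 1/120`). Proof as printed: dyadic selection
(`dyadic_selection`) applied to the closest indices of Corollary 16, then Lemma 5 and Lemma 11.
[cite: NguyenRoy2016, Proposition 17] -/
theorem prop17 (hσ1 : 1 ≤ σ) (hβ : σ + 1 < β) (hν : 2 < ν) :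
    ∃ D₁ : ℕ, ∀ D : ℕ, D₁ ≤ D → E.D₀ ≤ D ∧ ∃ m : ℕ, m < ⌊(D : ℝ) ^ σ⌋₊ ∧
      ∀ n : ℕ, 1 ≤ n → n ≤ ⌊(D : ℝ) ^ σ⌋₊ →
        ∃ ι : E.Pt → ℤ, (∀ b ∈ E.pts (E.τV (-(m : ℤ)) (E.Z D)), |ι b| < n) ∧
          ∑ b ∈ E.pts (E.τV (-(m : ℤ)) (E.Z D)), Real.log (E.dist b (E.γ (ι b))) ≤
            -(n * (E.κ / 4) * (D : ℝ) ^ (ν - β - 2) *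
              ((D : ℝ) ^ β * (E.pts (E.τV (-(m : ℤ)) (E.Z D))).card
                + D * E.ht (E.τV (-(m : ℤ)) (E.Z D)))) := by
  -- thresholds: `c₁ D^σ ≤ D^β`, `2c₄ D^{1+σ} ≤ D^β`, `8 log 2 / κ ≤ D^{ν-2}`, `D ≥ max D₀ 1`
  have ev1 : ∀ᶠ D : ℕ in atTop, E.c₁ * (D : ℝ) ^ σ ≤ (D : ℝ) ^ β :=
    eventually_mul_rpow_le_rpow _ (by linarith)
  have ev2 : ∀ᶠ D : ℕ in atTop, (2 * E.c₄) * (D : ℝ) ^ (1 + σ) ≤ (D : ℝ) ^ β :=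
    eventually_mul_rpow_le_rpow _ (by linarith)
  have ev3 : ∀ᶠ D : ℕ in atTop, (8 * Real.log 2 / E.κ) * (D : ℝ) ^ (0 : ℝ) ≤ (D : ℝ) ^ (ν - 2) :=
    eventually_mul_rpow_le_rpow _ (by linarith)
  obtain ⟨D₁, hD₁⟩ := Filter.eventually_atTop.mp
    (ev1.and (ev2.and (ev3.and (eventually_ge_atTop (max E.D₀ 1)))))
  refine ⟨D₁, fun D hD => ?_⟩
  obtain ⟨h1, h2, h3, h4⟩ := hD₁ D hD
  have hD0 : E.D₀ ≤ D := le_trans (le_max_left _ _) h4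
  have hD1 : 1 ≤ D := le_trans (le_max_right _ _) h4
  refine ⟨hD0, ?_⟩
  have hDr : (1 : ℝ) ≤ D := by exact_mod_cast hD1
  have hDpos : (0 : ℝ) < D := by linarith
  rw [Real.rpow_zero, mul_one] at h3
  -- Corollary 16
  obtain ⟨ι, hι, hsum⟩ := E.cor16 D hD0
  set T : ℕ := ⌊(D : ℝ) ^ σ⌋₊ with hT
  set A := E.pts (E.Z D) with hA
  have hTσ : (T : ℝ) ≤ (D : ℝ) ^ σ := Nat.floor_le (Real.rpow_nonneg hDpos.le _)
  have h1σ : (1 : ℝ) ≤ (D : ℝ) ^ σ := Real.one_le_rpow hDr (by linarith)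
  have h1T : 1 ≤ T := Nat.le_floor (by exact_mod_cast h1σ)
  have hcard : (1 : ℝ) ≤ A.card := E.one_le_card _
  -- the data of the dyadic selection
  set t : E.Pt → ℕ := fun a => (ι a).toNat with ht_def
  set δ : E.Pt → ℝ := fun a => min 0 ((D : ℝ) ^ β + Real.log (E.dist a (E.γ (ι a)))) with hδ_def
  set X : ℝ := 2 * (D : ℝ) ^ β * A.card + D * E.ht (E.Z D) with hX_def
  set B : ℝ := E.κ / 4 * (D : ℝ) ^ (ν - β - 2) * X with hB_def
  have hβpos : (0 : ℝ) < (D : ℝ) ^ β := Real.rpow_pos_of_pos hDpos _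
  have hPpos : (0 : ℝ) < (D : ℝ) ^ (ν - β - 2) := Real.rpow_pos_of_pos hDpos _
  have hX : 0 < X := by
    have : 0 ≤ (D : ℝ) * E.ht (E.Z D) := mul_nonneg hDpos.le (E.ht_nonneg _)
    have : 0 < 2 * (D : ℝ) ^ β * A.card := by positivity
    linarith
  have hB : 0 < B := by
    have := E.κ_pos
    positivity
  set k : ℕ := Nat.log 2 T + 1 with hk
  have hTk : T < 2 ^ k := Nat.lt_pow_succ_log_self (by norm_num) T
  have h2k : (2 : ℝ) ^ (k + 1) ≤ 4 * (D : ℝ) ^ σ := by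
    have hl : 2 ^ (Nat.log 2 T) ≤ T := Nat.pow_log_le_self 2 (by omega)
    have hl' : ((2 : ℕ) ^ (Nat.log 2 T) : ℝ) ≤ T := by exact_mod_cast hl
    have e : (2 : ℝ) ^ (k + 1) = 4 * ((2 : ℕ) ^ (Nat.log 2 T) : ℝ) := by
      rw [hk, pow_succ, pow_succ]
      push_cast
      ring
    rw [e]
    linarith
  -- `∑ δ ≤ -(2^(k+1) B)`
  have hδsum : ∑ a ∈ A, δ a ≤ -(2 ^ (k + 1) * B) := by
    have s1 : ∑ a ∈ A, δ a ≤ ∑ a ∈ A, ((D : ℝ) ^ β + Real.log (E.dist a (E.γ (ι a)))) :=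
      Finset.sum_le_sum fun a _ => min_le_right _ _
    have s2 : E.κ * (D : ℝ) ^ (ν - β + σ - 2) * X = 4 * (D : ℝ) ^ σ * B := by
      rw [hB_def, show ν - β + σ - 2 = σ + (ν - β - 2) by ring, Real.rpow_add hDpos]
      ring
    have s3 : (2 : ℝ) ^ (k + 1) * B ≤ 4 * (D : ℝ) ^ σ * B := mul_le_mul_of_nonneg_right h2k hB.le
    linarith [hsum]
  have htk : ∀ a ∈ A, t a < 2 ^ k := fun a ha => by
    have h0 := (hι a ha).1
    have h1' := (hι a ha).2
    simp only [ht_def]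
    omega
  have hδ0 : ∀ a ∈ A, δ a ≤ 0 := fun a _ => min_le_left _ _
  obtain ⟨m, -, hmem, hsel⟩ := dyadic_selection A t δ hB.le hδ0 k htk hδsum
  obtain ⟨a₀, ha₀, hta₀⟩ := hmem hB
  have hmT : m < T := by
    have h0 := (hι a₀ ha₀).1
    have h1' := (hι a₀ ha₀).2
    simp only [ht_def] at hta₀
    omega
  have hmσ : (m : ℝ) ≤ (D : ℝ) ^ σ := le_trans (by exact_mod_cast hmT.le) hTσ
  refine ⟨m, hmT, fun n hn1 hnT => ?_⟩
  have hn2k : n ≤ 2 ^ k := by omega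
  have hsel' := hsel n hn1 hn2k
  set Zt := E.τV (-(m : ℤ)) (E.Z D) with hZt
  -- the index function on the translate
  refine ⟨fun b => if t (E.τ m b) < m + n ∧ m < t (E.τ m b) + n then ι (E.τ m b) - m else 0,
    ?_, ?_⟩
  · intro b hb
    obtain ⟨a, ha, rfl⟩ := (E.mem_pts_τV _ _ b).mp hb
    have hτ : E.τ (m : ℤ) (E.τ (-(m : ℤ)) a) = a := E.τ_τ_neg _ _
    simp only [hτ]
    split_ifs with hnear
    · have h0 := (hι a ha).1
      simp only [ht_def] at hnear
      rw [abs_lt]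
      constructor <;> omega
    · simp only [abs_zero]
      exact_mod_cast hn1
  · rw [E.sum_pts_τV]
    -- termwise estimate
    have hterm : ∀ a ∈ A, Real.log (E.dist (E.τ (-(m : ℤ)) a)
        (E.γ (if t (E.τ m (E.τ (-(m : ℤ)) a)) < m + n ∧ m < t (E.τ m (E.τ (-(m : ℤ)) a)) + n
          then ι (E.τ m (E.τ (-(m : ℤ)) a)) - m else 0))) ≤
        Real.log 2 + if t a < m + n ∧ m < t a + n then δ a else 0 := by
      intro a ha
      have hτ : E.τ (m : ℤ) (E.τ (-(m : ℤ)) a) = a := E.τ_τ_neg _ _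
      simp only [hτ]
      have hpos : ∀ i, 0 < E.dist (E.τ (-(m : ℤ)) a) (E.γ i) := fun i =>
        E.dist_γ_pos Zt _ (E.τ_mem_pts_τV _ _ ha) i
      have hle2 : ∀ i, Real.log (E.dist (E.τ (-(m : ℤ)) a) (E.γ i)) ≤ Real.log 2 := fun i =>
        Real.log_le_log (hpos i) (E.dist_le_two _ _)
      split_ifs with hnear
      · have hγ : E.γ (ι a - m) = E.τ (-(m : ℤ)) (E.γ (ι a)) := by
          rw [E.τ_γ]; ring_nf
        have hposa : 0 < E.dist a (E.γ (ι a)) := E.dist_γ_pos (E.Z D) a ha _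
        have hd : E.dist (E.τ (-(m : ℤ)) a) (E.γ (ι a - m)) ≤
            Real.exp (E.c₁ * m) * E.dist a (E.γ (ι a)) := by
          rw [hγ]
          have := E.dist_τ_le (-(m : ℤ)) a (E.γ (ι a))
          simpa [abs_neg] using this
        have hlog : Real.log (E.dist (E.τ (-(m : ℤ)) a) (E.γ (ι a - m))) ≤
            E.c₁ * m + Real.log (E.dist a (E.γ (ι a))) := by
          have := Real.log_le_log (hpos _) hd
          rwa [Real.log_mul (Real.exp_pos _).ne' hposa.ne', Real.log_exp] at this
        have hcm : E.c₁ * m ≤ (D : ℝ) ^ β :=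
          le_trans (mul_le_mul_of_nonneg_left hmσ E.c₁_nonneg) h1
        have hlog2 : (0 : ℝ) ≤ Real.log 2 := Real.log_nonneg (by norm_num)
        simp only [hδ_def]
        rcases le_total 0 ((D : ℝ) ^ β + Real.log (E.dist a (E.γ (ι a)))) with hx | hx
        · rw [min_eq_left hx]
          linarith [hle2 (ι a - m)]
        · rw [min_eq_right hx]
          linarith
      · linarith [hle2 0]
    have hcardt : (E.pts Zt).card = A.card := E.card_pts_τV _ _
    -- height of the translate (Lemma 11)
    have hh : E.ht Zt ≤ E.ht (E.Z D) + E.c₄ * m * A.card := by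
      have := E.ht_τV_le (-(m : ℤ)) (E.Z D)
      simpa [abs_neg] using this
    have hPQ : (D : ℝ) ^ (ν - β - 2) * (D : ℝ) ^ β = (D : ℝ) ^ (ν - 2) := by
      rw [← Real.rpow_add hDpos]; ring_nf
    -- `c₄ m D ≤ D^β / 2`
    have hc4 : E.c₄ * m * (D : ℝ) ≤ (D : ℝ) ^ β / 2 := by
      have e1 : E.c₄ * m * (D : ℝ) ≤ E.c₄ * (D : ℝ) ^ σ * D := by
        have := mul_le_mul_of_nonneg_left hmσ E.c₄_nonneg
        exact mul_le_mul_of_nonneg_right this hDpos.le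
      have e2 : (D : ℝ) ^ σ * D = (D : ℝ) ^ (1 + σ) := by
        rw [Real.rpow_add hDpos, Real.rpow_one]; ring
      calc E.c₄ * m * (D : ℝ) ≤ E.c₄ * (D : ℝ) ^ σ * D := e1
        _ = E.c₄ * (D : ℝ) ^ (1 + σ) := by rw [mul_assoc, e2]
        _ ≤ (D : ℝ) ^ β / 2 := by linarith [h2]
    -- the main bookkeeping: `A.card log 2 - n B ≤ -n B̃`
    have hBt : (n : ℝ) * (E.κ / 4 * (D : ℝ) ^ (ν - β - 2) * ((D : ℝ) ^ β * A.card + D * E.ht Zt))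
        + A.card * Real.log 2 ≤ n * B := by
      have hn : (1 : ℝ) ≤ n := by exact_mod_cast hn1
      -- `X ≥ (D^β card + D ht Zt) + D^β card / 2`
      have hX' : (D : ℝ) ^ β * A.card + D * E.ht Zt + (D : ℝ) ^ β * A.card / 2 ≤ X := by
        rw [hX_def]
        have hc0 : (0 : ℝ) ≤ A.card := by positivity
        have : (D : ℝ) * E.ht Zt ≤ D * E.ht (E.Z D) + (D : ℝ) ^ β / 2 * A.card := by
          have i1 := mul_le_mul_of_nonneg_left hh hDpos.le
          have i2 : E.c₄ * m * (D : ℝ) * A.card ≤ (D : ℝ) ^ β / 2 * A.card :=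
            mul_le_mul_of_nonneg_right hc4 hc0
          have i3 : (D : ℝ) * (E.ht (E.Z D) + E.c₄ * m * A.card) =
              D * E.ht (E.Z D) + E.c₄ * m * (D : ℝ) * A.card := by ring
          linarith [i1, i2, i3]
        linarith
      -- `card log 2 ≤ n (κ/8) D^{ν-2} card`
      have hl2 : (A.card : ℝ) * Real.log 2 ≤
          n * (E.κ / 4 * (D : ℝ) ^ (ν - β - 2) * ((D : ℝ) ^ β * A.card / 2)) := by
        have e1 : Real.log 2 ≤ E.κ / 8 * (D : ℝ) ^ (ν - 2) := by
          have h3' := h3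
          rw [div_le_iff₀ E.κ_pos] at h3'
          have : E.κ / 8 * (D : ℝ) ^ (ν - 2) = ((D : ℝ) ^ (ν - 2) * E.κ) / 8 := by ring
          rw [this]
          linarith
        have e2 : E.κ / 4 * (D : ℝ) ^ (ν - β - 2) * ((D : ℝ) ^ β * A.card / 2) =
            E.κ / 8 * (D : ℝ) ^ (ν - 2) * A.card := by rw [← hPQ]; ring
        rw [e2]
        have hc0 : (0 : ℝ) ≤ A.card := by positivity
        have e3 : (A.card : ℝ) * Real.log 2 ≤ E.κ / 8 * (D : ℝ) ^ (ν - 2) * A.card := by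
          rw [mul_comm (A.card : ℝ)]
          exact mul_le_mul_of_nonneg_right e1 hc0
        have e4 : 0 ≤ E.κ / 8 * (D : ℝ) ^ (ν - 2) * A.card := by
          have hκ8 : 0 ≤ E.κ / 8 := by linarith [E.κ_pos]
          exact mul_nonneg (mul_nonneg hκ8 (Real.rpow_nonneg hDpos.le _)) hc0
        calc (A.card : ℝ) * Real.log 2 ≤ E.κ / 8 * (D : ℝ) ^ (ν - 2) * A.card := e3
          _ = 1 * (E.κ / 8 * (D : ℝ) ^ (ν - 2) * A.card) := (one_mul _).symm
          _ ≤ n * (E.κ / 8 * (D : ℝ) ^ (ν - 2) * A.card) := mul_le_mul_of_nonneg_right hn e4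
      have hmono : (n : ℝ) * (E.κ / 4 * (D : ℝ) ^ (ν - β - 2) *
          ((D : ℝ) ^ β * A.card + D * E.ht Zt + (D : ℝ) ^ β * A.card / 2)) ≤ n * B := by
        rw [hB_def]
        have hκ := E.κ_pos
        have : E.κ / 4 * (D : ℝ) ^ (ν - β - 2) *
            ((D : ℝ) ^ β * A.card + D * E.ht Zt + (D : ℝ) ^ β * A.card / 2) ≤
            E.κ / 4 * (D : ℝ) ^ (ν - β - 2) * X :=
          mul_le_mul_of_nonneg_left hX' (by positivity)
        exact mul_le_mul_of_nonneg_left this (by positivity)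
      linarith [hmono, hl2]
    calc ∑ a ∈ A, Real.log (E.dist (E.τ (-(m : ℤ)) a)
          (E.γ (if t (E.τ m (E.τ (-(m : ℤ)) a)) < m + n ∧ m < t (E.τ m (E.τ (-(m : ℤ)) a)) + n
            then ι (E.τ m (E.τ (-(m : ℤ)) a)) - m else 0)))
        ≤ ∑ a ∈ A, (Real.log 2 + if t a < m + n ∧ m < t a + n then δ a else 0) :=
          Finset.sum_le_sum hterm
      _ = A.card * Real.log 2 + ∑ a ∈ A.filter (fun a => t a < m + n ∧ m < t a + n), δ a := by
          rw [Finset.sum_add_distrib, Finset.sum_const, nsmul_eq_mul, Finset.sum_filter]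
      _ ≤ A.card * Real.log 2 - n * B := by linarith [hsel']
      _ ≤ -(n * (E.κ / 4) * (D : ℝ) ^ (ν - β - 2) * ((D : ℝ) ^ β * (E.pts Zt).card
            + D * E.ht Zt)) := by
          rw [hcardt]
          linarith [hBt]

/-- Proposition 17 with the translation exponents chosen as a function `m : ℕ → ℕ`
(so that `Z̃_D = τ^{-m(D)}(Z_D)` is a well-defined sequence). [cite: NguyenRoy2016, Proposition 17] -/
theorem prop17' (hσ1 : 1 ≤ σ) (hβ : σ + 1 < β) (hν : 2 < ν) :
    ∃ D₁ : ℕ, ∃ mf : ℕ → ℕ, ∀ D : ℕ, D₁ ≤ D → E.D₀ ≤ D ∧ mf D < ⌊(D : ℝ) ^ σ⌋₊ ∧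
      ∀ n : ℕ, 1 ≤ n → n ≤ ⌊(D : ℝ) ^ σ⌋₊ →
        ∃ ι : E.Pt → ℤ, (∀ b ∈ E.pts (E.τV (-(mf D : ℤ)) (E.Z D)), |ι b| < n) ∧
          ∑ b ∈ E.pts (E.τV (-(mf D : ℤ)) (E.Z D)), Real.log (E.dist b (E.γ (ι b))) ≤
            -(n * (E.κ / 4) * (D : ℝ) ^ (ν - β - 2) *
              ((D : ℝ) ^ β * (E.pts (E.τV (-(mf D : ℤ)) (E.Z D))).card
                + D * E.ht (E.τV (-(mf D : ℤ)) (E.Z D)))) := by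
  classical
  obtain ⟨D₁, h⟩ := E.prop17 hσ1 hβ hν
  refine ⟨D₁, fun D => if hD : D₁ ≤ D then Classical.choose (h D hD).2 else 0, fun D hD => ?_⟩
  refine ⟨(h D hD).1, ?_⟩
  simp only [dif_pos hD]
  exact Classical.choose_spec (h D hD).2

/-- Averaging: if `∑_{i ∈ s} f i ≤ M` then `f i ≤ M / #s` for some `i ∈ s`. [folklore] -/
theorem exists_le_div_card {ι : Type*} {s : Finset ι} (hs : s.Nonempty) {f : ι → ℝ} {M : ℝ}
    (h : ∑ i ∈ s, f i ≤ M) : ∃ i ∈ s, f i ≤ M / s.card := by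
  have hc : (s.card : ℝ) ≠ 0 := by exact_mod_cast hs.card_pos.ne'
  have : ∑ i ∈ s, f i ≤ ∑ _i ∈ s, M / s.card := by
    rw [Finset.sum_const, nsmul_eq_mul, mul_div_cancel₀ _ hc]
    exact h
  exact Finset.exists_le_of_sum_le hs this

/-- **Corollary 18/19 device**: from the estimate of Proposition 17 at level `T*`, some point of
`Z̃_D` is within `exp(−T* (κ/4) D^{ν−2})` of some `γ_i`, `|i| < T*`.
[cite: NguyenRoy2016, Corollary 18, Corollary 19] -/
theorem exists_close_point {Zt : E.V} {n D : ℕ} (hD : 1 ≤ D) {ι : E.Pt → ℤ}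
    (h : ∑ b ∈ E.pts Zt, Real.log (E.dist b (E.γ (ι b))) ≤
      -(n * (E.κ / 4) * (D : ℝ) ^ (ν - β - 2) *
        ((D : ℝ) ^ β * (E.pts Zt).card + D * E.ht Zt))) :
    ∃ b ∈ E.pts Zt, E.dist b (E.γ (ι b)) ≤ Real.exp (-(n * (E.κ / 4) * (D : ℝ) ^ (ν - 2))) := by
  have hDpos : (0 : ℝ) < D := by exact_mod_cast hD
  have hcard : (1 : ℝ) ≤ (E.pts Zt).card := E.one_le_card _
  have hPQ : (D : ℝ) ^ (ν - β - 2) * (D : ℝ) ^ β = (D : ℝ) ^ (ν - 2) := by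
    rw [← Real.rpow_add hDpos]; ring_nf
  -- `∑ ≤ -(n κ/4 D^{ν-2}) * card`
  have h' : ∑ b ∈ E.pts Zt, Real.log (E.dist b (E.γ (ι b))) ≤
      -(n * (E.κ / 4) * (D : ℝ) ^ (ν - 2)) * (E.pts Zt).card := by
    have h0 : 0 ≤ (n : ℝ) * (E.κ / 4) * (D : ℝ) ^ (ν - β - 2) * (D * E.ht Zt) := by
      have := E.κ_pos
      have := E.ht_nonneg Zt
      have := Real.rpow_nonneg hDpos.le (ν - β - 2)
      positivity
    have e : (n : ℝ) * (E.κ / 4) * (D : ℝ) ^ (ν - β - 2) *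
        ((D : ℝ) ^ β * (E.pts Zt).card + D * E.ht Zt) =
        n * (E.κ / 4) * (D : ℝ) ^ (ν - 2) * (E.pts Zt).card +
          n * (E.κ / 4) * (D : ℝ) ^ (ν - β - 2) * (D * E.ht Zt) := by
      rw [← hPQ]; ring
    rw [e] at h
    linarith
  obtain ⟨b, hb, hle⟩ := exists_le_div_card (E.pts_nonempty Zt) h'
  refine ⟨b, hb, ?_⟩
  have hc : ((E.pts Zt).card : ℝ) ≠ 0 := by positivity
  rw [mul_div_assoc, div_self hc, mul_one] at hle
  have hpos : 0 < E.dist b (E.γ (ι b)) := E.dist_γ_pos Zt b hb _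
  rwa [← Real.log_le_iff_le_exp hpos]

/-- **The degrees or heights of the `Z̃_D` are unbounded** (§6, first display: "we deduce that
`lim max{deg(Z̃_D), h(Z̃_D)} = ∞`"): if along a sequence `Z̃_D` some point of `Z̃_D` tends to `γ₀`,
then for every bound `Bd` eventually `deg Z̃_D > Bd` or `h(Z̃_D) > Bd`. The paper invokes the
finiteness of the subvarieties of bounded degree and height; here Proposition 12 does the work:
distinct points of two subvarieties of degree and height `≤ Bd` are at distance `≥ C(Bd) > 0` from
each other, so the points within `C/8` of `γ₀` of the members of the sequence all belong to one
subvariety, whose finitely many points are at positive distance from `γ₀`.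
[cite: NguyenRoy2016, §6 (first paragraph)] -/
theorem eventually_lt_card_or_lt_ht (Zs : ℕ → E.V) {ε : ℕ → ℝ} (hε : Tendsto ε atTop (nhds 0))
    (hclose : ∀ᶠ D in atTop, ∃ a ∈ E.pts (Zs D), E.dist a (E.γ 0) ≤ ε D) (Bd : ℝ) :
    ∀ᶠ D in atTop, Bd < (E.pts (Zs D)).card ∨ Bd < E.ht (Zs D) := by
  classical
  -- the Liouville constant for two subvarieties of degree and height `≤ Bd`
  set C : ℝ := Real.exp (-(E.c₁₂ * Bd * Bd + Bd * Bd + Bd * Bd)) with hC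
  have hCpos : 0 < C := Real.exp_pos _
  have hεC : ∀ᶠ D in atTop, ε D < C / 8 := hε.eventually_lt_const (by positivity)
  by_contra hcon
  have hfreq : ∃ᶠ D in atTop, ((E.pts (Zs D)).card : ℝ) ≤ Bd ∧ E.ht (Zs D) ≤ Bd := by
    rw [Filter.not_eventually] at hcon
    refine hcon.mono fun D hD => ?_
    push Not at hD
    exact hD
  -- a first good level `D₁` and its subvariety `Z`
  obtain ⟨D₁, ⟨hcard₁, hht₁⟩, ⟨a₁, ha₁, hdist₁⟩, hε₁⟩ :=
    (hfreq.and_eventually (hclose.and hεC)).exists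
  set Z := Zs D₁ with hZ
  have hBd1 : 1 ≤ Bd := le_trans (by exact_mod_cast E.one_le_card Z) hcard₁
  -- every later good level has the same subvariety (Proposition 12 + weak triangle inequality)
  have hfreqZ : ∃ᶠ D in atTop, ∃ a ∈ E.pts Z, E.dist a (E.γ 0) ≤ ε D := by
    refine (hfreq.and_eventually (hclose.and hεC)).mono fun D hD => ?_
    obtain ⟨⟨hcard, hht⟩, ⟨a, ha, hdist⟩, hεD⟩ := hD
    by_cases haZ : a ∈ E.pts Z
    · exact ⟨a, haZ, hdist⟩
    · exfalso
      have hne : a ≠ a₁ := fun h => haZ (h ▸ ha₁)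
      have hL := E.liouville (Zs D) Z a ha a₁ ha₁ hne
      have hge : C ≤ E.dist a a₁ := by
        refine le_trans ?_ hL
        rw [hC]
        apply Real.exp_le_exp.mpr
        have h0 : (0 : ℝ) ≤ (E.pts (Zs D)).card := Nat.cast_nonneg _
        have h0' : (0 : ℝ) ≤ (E.pts Z).card := Nat.cast_nonneg _
        have e1 : E.c₁₂ * (E.pts (Zs D)).card * (E.pts Z).card ≤ E.c₁₂ * Bd * Bd := by
          rw [mul_assoc, mul_assoc]
          exact mul_le_mul_of_nonneg_left (mul_le_mul hcard hcard₁ h0' (by linarith))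
            E.c₁₂_nonneg
        have e2 : ((E.pts (Zs D)).card : ℝ) * E.ht Z ≤ Bd * Bd :=
          mul_le_mul hcard hht₁ (E.ht_nonneg _) (by linarith)
        have e3 : ((E.pts Z).card : ℝ) * E.ht (Zs D) ≤ Bd * Bd :=
          mul_le_mul hcard₁ hht (E.ht_nonneg _) (by linarith)
        linarith
      have hle : E.dist a a₁ ≤ 2 * (ε D + ε D₁) := by
        have h1 := E.dist_triangle a (E.γ 0) a₁
        rw [E.dist_comm (E.γ 0) a₁] at h1
        linarith
      linarith
  -- the finitely many points of `Z` are at positive distance from `γ₀`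
  obtain ⟨a₀, ha₀, hmin⟩ :=
    (E.pts Z).exists_min_image (fun a => E.dist a (E.γ 0)) (E.pts_nonempty Z)
  have hmpos : 0 < E.dist a₀ (E.γ 0) := E.dist_γ_pos Z a₀ ha₀ 0
  obtain ⟨D₂, ⟨a, ha, hdist⟩, hεD₂⟩ :=
    (hfreqZ.and_eventually (hε.eventually_lt_const hmpos)).exists
  exact absurd (lt_of_le_of_lt hdist hεD₂) (not_lt.mpr (hmin a ha))

/-- `(x + 1)^e ≤ 2 x^e` as soon as `x ≥ max(1, e / log 2)`. [folklore] -/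
theorem add_one_rpow_le_two_mul_rpow {e x : ℝ} (he : 0 ≤ e) (hx1 : 1 ≤ x)
    (hx : e / Real.log 2 ≤ x) : (x + 1) ^ e ≤ 2 * x ^ e := by
  have hxpos : 0 < x := by linarith
  have hlog2 : 0 < Real.log 2 := Real.log_pos (by norm_num)
  have h1 : x + 1 = x * (1 + 1 / x) := by field_simp
  have h2 : (1 + 1 / x) ^ e ≤ 2 := by
    have h3 : 1 + 1 / x ≤ Real.exp (1 / x) := by
      have := Real.add_one_le_exp (1 / x); linarith
    calc (1 + 1 / x) ^ e ≤ (Real.exp (1 / x)) ^ e :=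
          Real.rpow_le_rpow (by positivity) h3 he
      _ = Real.exp (e / x) := by rw [← Real.exp_mul]; ring_nf
      _ ≤ Real.exp (Real.log 2) := by
          apply Real.exp_le_exp.mpr
          rw [div_le_iff₀ hxpos]
          rw [div_le_iff₀ hlog2] at hx
          linarith
      _ = 2 := Real.exp_log (by norm_num)
  rw [h1, Real.mul_rpow hxpos.le (by positivity)]
  have := Real.rpow_nonneg hxpos.le e
  nlinarith

/-! ### Numerical lemmas for §6 -/

/-- Generic-constant form of `case_two_exponent_contradiction`: for `K₁, K₂ > 0`, under the
constraints of Theorem 1 with `σ < 3/2`, it is impossible that for arbitrarily large `D` there be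
`D* ≥ 1` with `D^{ν−2} ≤ K₁ (D*)^{3+β−3σ}` and `(D*)^{σ−1} ≤ K₂ D^{1+β−ν}`.
[cite: NguyenRoy2016, §6, Case 2 (last paragraph)] -/
theorem case_two_exponent_contradiction' {σ β ν K₁ K₂ : ℝ} (hK₁ : 0 < K₁) (hK₂ : 0 < K₂)
    (hσ1 : 1 ≤ σ) (hσ : σ < 3 / 2)
    (hβ : σ + 1 < β) (hν : 2 + β - σ + (σ - 1) * (3 - 2 * σ) / (2 + β - 2 * σ) < ν)
    (h : ∀ N : ℝ, ∃ D ≥ N, ∃ Ds : ℝ, 1 ≤ Ds ∧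
      D ^ (ν - 2) ≤ K₁ * Ds ^ (3 + β - 3 * σ) ∧ Ds ^ (σ - 1) ≤ K₂ * D ^ (1 + β - ν)) :
    False := by
  have hA : 0 < 2 + β - 2 * σ := by linarith
  have hE : 0 < 3 + β - 3 * σ := by linarith
  -- Step 1: `1 + β - ν ≥ 0`
  have step1 : (0 : ℝ) ≤ 1 + β - ν := by
    refine le_of_frequently_rpow_le (K := K₂) fun N => ?_
    obtain ⟨D, hD, Ds, hDs, -, h2⟩ := h N
    refine ⟨D, hD, ?_⟩
    rw [Real.rpow_zero]
    calc (1 : ℝ) ≤ Ds ^ (σ - 1) := Real.one_le_rpow hDs (by linarith)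
      _ ≤ K₂ * D ^ (1 + β - ν) := h2
  -- Step 2: `(σ - 1)(ν - 2) ≤ (1 + β - ν)(3 + β - 3σ)`
  have step2 : (σ - 1) * (ν - 2) ≤ (1 + β - ν) * (3 + β - 3 * σ) := by
    rcases eq_or_lt_of_le hσ1 with hσeq | hσgt
    · rw [← hσeq]
      have : (0 : ℝ) ≤ (1 + β - ν) * (3 + β - 3 * 1) := mul_nonneg step1 (by linarith)
      linarith
    · have hs : 0 < σ - 1 := by linarith
      have hs' : σ - 1 ≠ 0 := hs.ne'
      set q : ℝ := (3 + β - 3 * σ) / (σ - 1) with hq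
      have hq0 : 0 ≤ q := div_nonneg hE.le hs.le
      have hsq : (σ - 1) * q = 3 + β - 3 * σ := by rw [hq]; field_simp
      have key : ν - 2 ≤ (1 + β - ν) * q := by
        refine le_of_frequently_rpow_le (K := K₁ * K₂ ^ q) fun N => ?_
        obtain ⟨D, hD, Ds, hDs, h1, h2⟩ := h (max N 1)
        have hD1 : 1 ≤ D := le_trans (le_max_right _ _) hD
        have hDpos : 0 < D := by linarith
        have hDs0 : (0 : ℝ) ≤ Ds := by linarith
        refine ⟨D, le_trans (le_max_left _ _) hD, ?_⟩
        have e1 : Ds ^ (3 + β - 3 * σ) = (Ds ^ (σ - 1)) ^ q := by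
          rw [← Real.rpow_mul hDs0, hsq]
        have e2 : (Ds ^ (σ - 1)) ^ q ≤ (K₂ * D ^ (1 + β - ν)) ^ q :=
          Real.rpow_le_rpow (Real.rpow_nonneg hDs0 _) h2 hq0
        have e3 : (K₂ * D ^ (1 + β - ν)) ^ q = K₂ ^ q * D ^ ((1 + β - ν) * q) := by
          rw [Real.mul_rpow hK₂.le (Real.rpow_nonneg hDpos.le _), ← Real.rpow_mul hDpos.le]
        calc D ^ (ν - 2) ≤ K₁ * Ds ^ (3 + β - 3 * σ) := h1
          _ ≤ K₁ * (K₂ ^ q * D ^ ((1 + β - ν) * q)) := by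
              rw [e1]
              exact mul_le_mul_of_nonneg_left (e2.trans_eq e3) hK₁.le
          _ = K₁ * K₂ ^ q * D ^ ((1 + β - ν) * q) := by ring
      have key' : (σ - 1) * (ν - 2) ≤ (σ - 1) * ((1 + β - ν) * q) :=
        mul_le_mul_of_nonneg_left key hs.le
      calc (σ - 1) * (ν - 2) ≤ (σ - 1) * ((1 + β - ν) * q) := key'
        _ = (1 + β - ν) * ((σ - 1) * q) := by ring
        _ = (1 + β - ν) * (3 + β - 3 * σ) := by rw [hsq]
  -- Step 3: contradiction with the hypothesis on `ν`
  have hd : (σ - 1) * (3 - 2 * σ) / (2 + β - 2 * σ) < ν - (2 + β - σ) := by linarith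
  rw [div_lt_iff₀ hA] at hd
  have hid : (1 + β - ν) * (3 + β - 3 * σ) - (σ - 1) * (ν - 2) =
      (σ - 1) * (3 - 2 * σ) - (ν - (2 + β - σ)) * (2 + β - 2 * σ) := by ring
  linarith

/-- The correction term of Theorem 1 is non-negative on `1 ≤ σ ≤ 3/2`, so that in every case
`ν > 2 + β − σ`. [cite: NguyenRoy2016, Theorem 1, (1)] -/
theorem two_add_sub_lt_nu {σ β ν : ℝ} (hσ1 : 1 ≤ σ) (hβ : σ + 1 < β)
    (hν1 : 3 / 2 ≤ σ → 2 + β - σ < ν)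
    (hν2 : σ < 3 / 2 → 2 + β - σ + (σ - 1) * (3 - 2 * σ) / (2 + β - 2 * σ) < ν) :
    2 + β - σ < ν := by
  rcases le_or_gt (3 / 2) σ with h | h
  · exact hν1 h
  · have hA : 0 < 2 + β - 2 * σ := by linarith
    have : 0 ≤ (σ - 1) * (3 - 2 * σ) / (2 + β - 2 * σ) :=
      div_nonneg (mul_nonneg (by linarith) (by linarith)) hA.le
    linarith [hν2 h]

/-- Numerics of Case 1 of §6: `log 4 + c d^σ + p d^{2σ−2} + q d^β < (κ/8) d^{ν+σ−2}` for large `d`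
(the exponent `ν + σ − 2` beats `σ`, `2σ − 2`, `β` and `0`). [cite: NguyenRoy2016, §6, Case 1] -/
theorem case1_eventually {σ β ν κ c p q : ℝ} (hκ : 0 < κ) (hσ1 : 1 ≤ σ) (hσ2 : σ < 2)
    (hβ : σ + 1 < β) (hν : 2 + β - σ < ν) :
    ∀ᶠ d : ℕ in atTop, Real.log 4 + c * (d : ℝ) ^ σ + p * (d : ℝ) ^ (2 * σ - 2) +
      q * (d : ℝ) ^ β < κ / 8 * (d : ℝ) ^ (ν + σ - 2) := by
  have hν2 : 2 < ν := by linarith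
  have e0 := eventually_mul_rpow_le_rpow (40 / κ * Real.log 4) (a := 0) (b := ν + σ - 2)
    (by linarith)
  have e1 := eventually_mul_rpow_le_rpow (40 / κ * c) (a := σ) (b := ν + σ - 2) (by linarith)
  have e2 := eventually_mul_rpow_le_rpow (40 / κ * p) (a := 2 * σ - 2) (b := ν + σ - 2)
    (by linarith)
  have e3 := eventually_mul_rpow_le_rpow (40 / κ * q) (a := β) (b := ν + σ - 2) (by linarith)
  filter_upwards [e0, e1, e2, e3, eventually_ge_atTop 1] with d h0 h1 h2 h3 hd
  have hdpos : (0 : ℝ) < d := by exact_mod_cast hd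
  have hpow : 0 < (d : ℝ) ^ (ν + σ - 2) := Real.rpow_pos_of_pos hdpos _
  rw [Real.rpow_zero, mul_one] at h0
  have hk : 0 < 40 / κ := by positivity
  have hq : (d : ℝ) ^ (ν + σ - 2) / (40 / κ) = κ / 40 * (d : ℝ) ^ (ν + σ - 2) := by
    rw [div_div_eq_mul_div]; ring
  -- divide each estimate by `40/κ`
  have g0 : Real.log 4 ≤ κ / 40 * (d : ℝ) ^ (ν + σ - 2) := by
    rw [← hq]; exact (le_div_iff₀' hk).mpr h0
  have g1 : c * (d : ℝ) ^ σ ≤ κ / 40 * (d : ℝ) ^ (ν + σ - 2) := by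
    rw [← hq]; exact (le_div_iff₀' hk).mpr (by rw [← mul_assoc]; exact h1)
  have g2 : p * (d : ℝ) ^ (2 * σ - 2) ≤ κ / 40 * (d : ℝ) ^ (ν + σ - 2) := by
    rw [← hq]; exact (le_div_iff₀' hk).mpr (by rw [← mul_assoc]; exact h2)
  have g3 : q * (d : ℝ) ^ β ≤ κ / 40 * (d : ℝ) ^ (ν + σ - 2) := by
    rw [← hq]; exact (le_div_iff₀' hk).mpr (by rw [← mul_assoc]; exact h3)
  nlinarith [g0, g1, g2, g3, hpow, hκ]

/-- Numerics of Case 2, sub-case (i), of §6: with `deg ≤ 2A d^{2−σ}` and `h ≤ 2B d^{1+β−σ}`,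
`log 2 + deg (log 3 + 3d^β + c₇ d + c₄ d^{1+σ}) + d h < d^ν/2` for large `d` (all exponents on
the left are `< ν` since `ν > 2 + β − σ > 3`). [cite: NguyenRoy2016, §6, Case 2] -/
theorem case2i_eventually {σ β ν A B c₇ c₄ : ℝ} (hc₇ : 0 ≤ c₇)
    (hc₄ : 0 ≤ c₄) (hσ1 : 1 ≤ σ) (hβ : σ + 1 < β) (hν : 2 + β - σ < ν) :
    ∀ᶠ d : ℕ in atTop, ∀ deg h : ℝ, 0 ≤ deg → deg ≤ 2 * A * (d : ℝ) ^ (2 - σ) → 0 ≤ h →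
      h ≤ 2 * B * (d : ℝ) ^ (1 + β - σ) →
      Real.log 2 + deg * (Real.log 3 + 3 * (d : ℝ) ^ β + c₇ * d + c₄ * (d : ℝ) ^ (1 + σ)) +
        d * h < (d : ℝ) ^ ν / 2 := by
  have hν3 : 3 < ν := by linarith
  have e0 := eventually_mul_rpow_le_rpow (14 * Real.log 2) (a := 0) (b := ν) (by linarith)
  have e1 := eventually_mul_rpow_le_rpow (14 * (2 * A * Real.log 3)) (a := 2 - σ) (b := ν)
    (by linarith)
  have e2 := eventually_mul_rpow_le_rpow (14 * (2 * A * 3)) (a := 2 - σ + β) (b := ν)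
    (by linarith)
  have e3 := eventually_mul_rpow_le_rpow (14 * (2 * A * c₇)) (a := 2 - σ + 1) (b := ν)
    (by linarith)
  have e4 := eventually_mul_rpow_le_rpow (14 * (2 * A * c₄)) (a := 2 - σ + (1 + σ)) (b := ν)
    (by linarith)
  have e5 := eventually_mul_rpow_le_rpow (14 * (2 * B)) (a := 1 + (1 + β - σ)) (b := ν)
    (by linarith)
  filter_upwards [e0, e1, e2, e3, e4, e5, eventually_ge_atTop 1] with d h0 h1 h2 h3 h4 h5 hd
  intro deg h hdeg0 hdeg hh0 hh
  have hdpos : (0 : ℝ) < d := by exact_mod_cast hd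
  have hpow : 0 < (d : ℝ) ^ ν := Real.rpow_pos_of_pos hdpos _
  rw [Real.rpow_zero, mul_one] at h0
  rw [Real.rpow_add hdpos] at h2 h3 h4 h5
  rw [Real.rpow_one] at h3 h5
  have hlog3 : 0 ≤ Real.log 3 := Real.log_nonneg (by norm_num)
  have hR : 0 ≤ Real.log 3 + 3 * (d : ℝ) ^ β + c₇ * d + c₄ * (d : ℝ) ^ (1 + σ) := by positivity
  -- replace `deg` and `h` by their bounds
  have s1 : deg * (Real.log 3 + 3 * (d : ℝ) ^ β + c₇ * d + c₄ * (d : ℝ) ^ (1 + σ)) ≤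
      2 * A * (d : ℝ) ^ (2 - σ) * (Real.log 3 + 3 * (d : ℝ) ^ β + c₇ * d + c₄ * (d : ℝ) ^ (1 + σ)) :=
    mul_le_mul_of_nonneg_right hdeg hR
  have s2 : (d : ℝ) * h ≤ d * (2 * B * (d : ℝ) ^ (1 + β - σ)) := mul_le_mul_of_nonneg_left hh hdpos.le
  nlinarith [s1, s2, h0, h1, h2, h3, h4, h5, hpow]

/-- Numerics of Case 2, sub-case (ii), of §6: `log 2 + 3d^β + c₇ d + c₄ d^{1+σ} ≤ (κ/16) d^{σ+ν−2}`
for large `d`. [cite: NguyenRoy2016, §6, Case 2] -/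
theorem case2ii_eventually {σ β ν κ c₇ c₄ : ℝ} (hκ : 0 < κ) (hσ1 : 1 ≤ σ)
    (hβ : σ + 1 < β) (hν : 2 + β - σ < ν) :
    ∀ᶠ d : ℕ in atTop, Real.log 2 + 3 * (d : ℝ) ^ β + c₇ * d + c₄ * (d : ℝ) ^ (1 + σ) ≤
      κ / 16 * (d : ℝ) ^ (σ + ν - 2) := by
  have hν3 : 3 < ν := by linarith
  have e0 := eventually_mul_rpow_le_rpow (64 / κ * Real.log 2) (a := 0) (b := σ + ν - 2)
    (by linarith)
  have e1 := eventually_mul_rpow_le_rpow (64 / κ * 3) (a := β) (b := σ + ν - 2) (by linarith)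
  have e2 := eventually_mul_rpow_le_rpow (64 / κ * c₇) (a := 1) (b := σ + ν - 2) (by linarith)
  have e3 := eventually_mul_rpow_le_rpow (64 / κ * c₄) (a := 1 + σ) (b := σ + ν - 2)
    (by linarith)
  filter_upwards [e0, e1, e2, e3, eventually_ge_atTop 1] with d h0 h1 h2 h3 hd
  have hdpos : (0 : ℝ) < d := by exact_mod_cast hd
  have hpow : 0 < (d : ℝ) ^ (σ + ν - 2) := Real.rpow_pos_of_pos hdpos _
  rw [Real.rpow_zero, mul_one] at h0
  rw [Real.rpow_one] at h2
  have hk : 0 < 64 / κ := by positivity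
  have hq : (d : ℝ) ^ (σ + ν - 2) / (64 / κ) = κ / 64 * (d : ℝ) ^ (σ + ν - 2) := by
    rw [div_div_eq_mul_div]; ring
  have g : ∀ y : ℝ, 64 / κ * y ≤ (d : ℝ) ^ (σ + ν - 2) → y ≤ κ / 64 * (d : ℝ) ^ (σ + ν - 2) := by
    intro y hy
    rw [← hq]
    exact (le_div_iff₀' hk).mpr hy
  have g0 := g _ h0
  have g1 := g _ (by rw [← mul_assoc]; exact h1)
  have g2 := g _ (by rw [← mul_assoc]; exact h2)
  have g3 := g _ (by rw [← mul_assoc]; exact h3)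
  linarith

/-- The constant of the point-value estimate: `(d+2)³ e^{2d^β} e^{c₁ d^σ} ≤ e^{3d^β}` for large `d`.
[cite: NguyenRoy2016, §6, Case 2 ((6.5) ⇒ (6.6))] -/
theorem coeff_eventually {σ β c₁ : ℝ} (hσ1 : 1 ≤ σ) (hβ : σ + 1 < β) :
    ∀ᶠ d : ℕ in atTop, ((d : ℝ) + 2) ^ 3 * Real.exp (2 * (d : ℝ) ^ β) * Real.exp (c₁ * (d : ℝ) ^ σ)
      ≤ Real.exp (3 * (d : ℝ) ^ β) := by
  have e1 := eventually_mul_rpow_le_rpow (3 * 3) (a := 1) (b := β) (by linarith)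
  have e2 := eventually_mul_rpow_le_rpow (3 * 3) (a := 0) (b := β) (by linarith)
  have e3 := eventually_mul_rpow_le_rpow (3 * c₁) (a := σ) (b := β) (by linarith)
  filter_upwards [e1, e2, e3, eventually_ge_atTop 1] with d h1 h2 h3 hd
  have hdpos : (0 : ℝ) < d := by exact_mod_cast hd
  rw [Real.rpow_one] at h1
  rw [Real.rpow_zero, mul_one] at h2
  -- `(d+2)^3 ≤ exp(3(d+1))`
  have hcube : ((d : ℝ) + 2) ^ 3 ≤ Real.exp (3 * ((d : ℝ) + 1)) := by
    have h := Real.add_one_le_exp ((d : ℝ) + 1)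
    have h0 : (0 : ℝ) ≤ (d : ℝ) + 2 := by positivity
    calc ((d : ℝ) + 2) ^ 3 = ((d : ℝ) + 1 + 1) ^ 3 := by ring
      _ ≤ (Real.exp ((d : ℝ) + 1)) ^ 3 := by
          exact pow_le_pow_left₀ (by linarith) h 3
      _ = Real.exp (3 * ((d : ℝ) + 1)) := by rw [← Real.exp_nat_mul]; norm_num
  calc ((d : ℝ) + 2) ^ 3 * Real.exp (2 * (d : ℝ) ^ β) * Real.exp (c₁ * (d : ℝ) ^ σ)
      ≤ Real.exp (3 * ((d : ℝ) + 1)) * Real.exp (2 * (d : ℝ) ^ β) * Real.exp (c₁ * (d : ℝ) ^ σ) := by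
        gcongr
    _ = Real.exp (3 * ((d : ℝ) + 1) + 2 * (d : ℝ) ^ β + c₁ * (d : ℝ) ^ σ) := by
        rw [Real.exp_add, Real.exp_add]
    _ ≤ Real.exp (3 * (d : ℝ) ^ β) := by
        apply Real.exp_le_exp.mpr
        linarith

/-! ### The regime of §6: `Z̃_D`, the auxiliary level `D*`, (6.2) and (6.3) -/

/-- Casting `|i| < n` from `ℤ` to `ℝ`. [folklore] -/
theorem abs_cast_lt_of_abs_lt {i : ℤ} {n : ℕ} (h : |i| < (n : ℤ)) : |(i : ℝ)| < n := by
  rw [← Int.cast_abs]; exact_mod_cast h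

/-- If `Z̃` violates the bounds of Proposition 14 at level `D*`, then no translate `τ^i Z̃`,
`|i| < 3⌊(D*)^σ⌋`, is contained in `W_{D*}`. [cite: NguyenRoy2016, §6 (proof of (6.2))] -/
theorem not_isIn_of_crit {Ds : ℕ} (hDs0 : E.D₀ ≤ Ds) {Zt : E.V}
    (hcrit : E.A₁₄ * (Ds : ℝ) ^ (2 - σ) < (E.pts Zt).card ∨
      E.B₁₄ * (Ds : ℝ) ^ (1 + β - σ) < E.ht Zt)
    {i : ℤ} (hi : |(i : ℝ)| < 3 * ⌊(Ds : ℝ) ^ σ⌋₊) : ¬ E.IsIn (E.τV i Zt) Ds := by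
  intro hin
  have h := E.prop14 Ds hDs0 _ hin (-i) (by simpa using hi)
  rw [τV_neg_τV] at h
  rcases hcrit with hc | hc <;> linarith [h.1, h.2]

/-- **(6.2)**, point form: if `Z̃_D` violates the bounds of Proposition 14 at level `D*`, then
`τ^i(Z̃_D)` and `τ^j(Z̃_{D*})` have no point in common for `|i|, |j| < ⌊(D*)^σ⌋` (here
`Z̃_{D*} = τ^{-m}(Z_{D*})` with `0 ≤ m < ⌊(D*)^σ⌋` and `Z_{D*} ⊆ W_{D*}`): a common point `b` would
give the point `τ^{m-j} b` of `Z_{D*} ⊆ W_{D*}` on `τ^{m-j+i}(Z̃_D)`, forcing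
`τ^{m-j+i}(Z̃_D) ⊆ W_{D*}`, against Proposition 14. [cite: NguyenRoy2016, §6, (6.2)] -/
theorem ne_translates {Ds mDs : ℕ} (hDs0 : E.D₀ ≤ Ds) (hmDs : mDs < ⌊(Ds : ℝ) ^ σ⌋₊)
    {Zt : E.V} (hcrit : E.A₁₄ * (Ds : ℝ) ^ (2 - σ) < (E.pts Zt).card ∨
      E.B₁₄ * (Ds : ℝ) ^ (1 + β - σ) < E.ht Zt)
    {i j : ℤ} (hi : |(i : ℝ)| < ⌊(Ds : ℝ) ^ σ⌋₊) (hj : |(j : ℝ)| < ⌊(Ds : ℝ) ^ σ⌋₊)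
    {b b' : E.Pt} (hb : b ∈ E.pts (E.τV i Zt))
    (hb' : b' ∈ E.pts (E.τV j (E.τV (-(mDs : ℤ)) (E.Z Ds)))) : b ≠ b' := by
  intro heq
  subst heq
  -- the point `c = τ^{m-j} b` lies on `τ^{m-j+i} Z̃` and on `Z_{D*}`
  have hc1 : E.τ ((mDs : ℤ) - j) b ∈ E.pts (E.τV ((mDs : ℤ) - j + i) Zt) := by
    rw [← E.τV_τV]; exact E.τ_mem_pts_τV _ _ hb
  have hc2 : E.τ ((mDs : ℤ) - j) b ∈ E.pts (E.Z Ds) := by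
    have h := E.τ_mem_pts_τV ((mDs : ℤ) - j) _ hb'
    rwa [E.τV_τV, E.τV_τV, show (mDs : ℤ) - j + j + -(mDs : ℤ) = 0 by ring, E.τV_zero] at h
  have hin : E.IsIn (E.τV ((mDs : ℤ) - j + i) Zt) Ds :=
    E.isIn_of_mem Ds _ _ _ hc2 hc1 (E.isIn_Z Ds hDs0)
  refine E.not_isIn_of_crit hDs0 hcrit ?_ hin
  have hm : ((mDs : ℤ) : ℝ) < ⌊(Ds : ℝ) ^ σ⌋₊ := by exact_mod_cast hmDs
  have hm0 : (0 : ℝ) ≤ ((mDs : ℤ) : ℝ) := by exact_mod_cast Nat.zero_le _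
  push_cast
  calc |(mDs : ℝ) - j + i| ≤ |(mDs : ℝ) - j| + |(i : ℝ)| := abs_add_le _ _
    _ ≤ |(mDs : ℝ)| + |(j : ℝ)| + |(i : ℝ)| := by linarith [abs_sub (mDs : ℝ) j]
    _ < 3 * ⌊(Ds : ℝ) ^ σ⌋₊ := by
        rw [abs_of_nonneg (by exact_mod_cast Nat.zero_le mDs)]
        push_cast at hm
        linarith

/-- **`Z̃_D` itself obeys the bounds of Proposition 14 at level `D`** (so that `D* < D`).
[cite: NguyenRoy2016, §6 ("In particular, this means that D* ≠ D")] -/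
theorem bounds_self {D mD : ℕ} (hD0 : E.D₀ ≤ D) (hmD : mD < ⌊(D : ℝ) ^ σ⌋₊) :
    ((E.pts (E.τV (-(mD : ℤ)) (E.Z D))).card : ℝ) ≤ E.A₁₄ * (D : ℝ) ^ (2 - σ) ∧
      E.ht (E.τV (-(mD : ℤ)) (E.Z D)) ≤ E.B₁₄ * (D : ℝ) ^ (1 + β - σ) := by
  refine E.prop14 D hD0 _ (E.isIn_Z D hD0) _ ?_
  have hm : ((mD : ℤ) : ℝ) < ⌊(D : ℝ) ^ σ⌋₊ := by exact_mod_cast hmD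
  push_cast at hm ⊢
  rw [abs_neg, abs_of_nonneg (by exact_mod_cast Nat.zero_le mD)]
  have : (0 : ℝ) ≤ ⌊(D : ℝ) ^ σ⌋₊ := by exact_mod_cast Nat.zero_le _
  linarith

/-- The good translate `Z̃_D = τ^{-m(D)}(Z_D)` of Proposition 17. [cite: NguyenRoy2016, Proposition 17] -/
def zt (mf : ℕ → ℕ) (D : ℕ) : E.V := E.τV (-(mf D : ℤ)) (E.Z D)

open scoped Classical in
/-- The auxiliary level `D*` of §6: the largest integer `d ≤ D` with
`deg(Z̃_D) > A₁₄ d^{2−σ}` or `h(Z̃_D) > B₁₄ d^{1+β−σ}` ((6.1); it is `< D`, and the largest such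
integer over all of `ℕ`, by `bounds_self`). [cite: NguyenRoy2016, §6, (6.1)] -/
def dstar (mf : ℕ → ℕ) (D : ℕ) : ℕ :=
  Nat.findGreatest (fun d : ℕ => E.A₁₄ * (d : ℝ) ^ (2 - σ) < ((E.pts (E.zt mf D)).card : ℝ) ∨
    E.B₁₄ * (d : ℝ) ^ (1 + β - σ) < E.ht (E.zt mf D)) D

open scoped Classical in
/-- `D* ≤ D`. [cite: NguyenRoy2016, §6, (6.1)] -/
theorem dstar_le (mf : ℕ → ℕ) (D : ℕ) : E.dstar mf D ≤ D := Nat.findGreatest_le _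

open scoped Classical in
/-- `D*` satisfies (6.1) as soon as some `d ≤ D` does. [cite: NguyenRoy2016, §6, (6.1)] -/
theorem dstar_spec (mf : ℕ → ℕ) {D d : ℕ} (hd : d ≤ D)
    (h : E.A₁₄ * (d : ℝ) ^ (2 - σ) < ((E.pts (E.zt mf D)).card : ℝ) ∨
      E.B₁₄ * (d : ℝ) ^ (1 + β - σ) < E.ht (E.zt mf D)) :
    E.A₁₄ * (E.dstar mf D : ℝ) ^ (2 - σ) < ((E.pts (E.zt mf D)).card : ℝ) ∨
      E.B₁₄ * (E.dstar mf D : ℝ) ^ (1 + β - σ) < E.ht (E.zt mf D) :=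
  Nat.findGreatest_spec (P := fun d : ℕ => E.A₁₄ * (d : ℝ) ^ (2 - σ) <
    ((E.pts (E.zt mf D)).card : ℝ) ∨ E.B₁₄ * (d : ℝ) ^ (1 + β - σ) < E.ht (E.zt mf D)) hd h

open scoped Classical in
/-- Every `d ≤ D` satisfying (6.1) is `≤ D*`. [cite: NguyenRoy2016, §6, (6.1)] -/
theorem le_dstar (mf : ℕ → ℕ) {D d : ℕ} (hd : d ≤ D)
    (h : E.A₁₄ * (d : ℝ) ^ (2 - σ) < ((E.pts (E.zt mf D)).card : ℝ) ∨
      E.B₁₄ * (d : ℝ) ^ (1 + β - σ) < E.ht (E.zt mf D)) : d ≤ E.dstar mf D :=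
  Nat.le_findGreatest (P := fun d : ℕ => E.A₁₄ * (d : ℝ) ^ (2 - σ) <
    ((E.pts (E.zt mf D)).card : ℝ) ∨ E.B₁₄ * (d : ℝ) ^ (1 + β - σ) < E.ht (E.zt mf D)) hd h

open scoped Classical in
/-- **(6.3)**: `D* + 1` violates (6.1) when `D* + 1 ≤ D`. [cite: NguyenRoy2016, §6, (6.3)] -/
theorem not_crit_dstar_succ (mf : ℕ → ℕ) {D : ℕ} (h : E.dstar mf D + 1 ≤ D) :
    ¬ (E.A₁₄ * ((E.dstar mf D + 1 : ℕ) : ℝ) ^ (2 - σ) < ((E.pts (E.zt mf D)).card : ℝ) ∨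
      E.B₁₄ * ((E.dstar mf D + 1 : ℕ) : ℝ) ^ (1 + β - σ) < E.ht (E.zt mf D)) :=
  Nat.findGreatest_is_greatest (P := fun d : ℕ => E.A₁₄ * (d : ℝ) ^ (2 - σ) <
    ((E.pts (E.zt mf D)).card : ℝ) ∨ E.B₁₄ * (d : ℝ) ^ (1 + β - σ) < E.ht (E.zt mf D))
    (Nat.lt_succ_self _) h

/-! ### §6, Case 2 -/

/-- **Case 2 of §6** (one level `D` with `deg(Z̃_D) > 2A₁₄ (D*)^{σ−1}`, `d = D*` large): the two
inequalities `D^{ν−2} ≤ (16B₁₄/(κA₁₄)) d^{3+β−3σ}` and `d^{σ−1} ≤ (8/κ) D^{1+β−ν}` (printed with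
the constants `350` and `150`). Proof as printed: `Z = τ^{T*−1}(Z̃_D) ⊄ W_{D*}` gives the
polynomial `P = Φʲ(P̃_{D*})` (`notIn`), whose values at the points of `Z` are bounded below in the
mean ([R2012] Prop. 2.3) and above pointwise ((6.5)); the sub-case where some value is
`≤ 2e^{−(D*)^ν/2}` is absurd for `D*` large, and otherwise Proposition 17 at level `T*` yields
the two inequalities. [cite: NguyenRoy2016, §6, Case 2] -/
theorem case2_core (hσ1 : 1 ≤ σ) (hβ : σ + 1 < β) (hν : 2 + β - σ < ν)
    {D d : ℕ} {Zt : E.V} (hd1 : 1 ≤ d) (hdD : d < D) (hd0 : E.D₀ ≤ d)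
    (hN₂ : ∀ deg h : ℝ, 0 ≤ deg → deg ≤ 2 * E.A₁₄ * (d : ℝ) ^ (2 - σ) → 0 ≤ h →
      h ≤ 2 * E.B₁₄ * (d : ℝ) ^ (1 + β - σ) →
      Real.log 2 + deg * (Real.log 3 + 3 * (d : ℝ) ^ β + E.c₇ * d + E.c₄ * (d : ℝ) ^ (1 + σ)) +
        d * h < (d : ℝ) ^ ν / 2)
    (hN₃ : Real.log 2 + 3 * (d : ℝ) ^ β + E.c₇ * d + E.c₄ * (d : ℝ) ^ (1 + σ) ≤
      E.κ / 16 * (d : ℝ) ^ (σ + ν - 2))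
    (hN₄ : ((d : ℝ) + 2) ^ 3 * Real.exp (2 * (d : ℝ) ^ β) * Real.exp (E.c₁ * (d : ℝ) ^ σ)
      ≤ Real.exp (3 * (d : ℝ) ^ β))
    (hcrit : E.A₁₄ * (d : ℝ) ^ (2 - σ) < (E.pts Zt).card ∨
      E.B₁₄ * (d : ℝ) ^ (1 + β - σ) < E.ht Zt)
    (hdeg : ((E.pts Zt).card : ℝ) ≤ 2 * E.A₁₄ * (d : ℝ) ^ (2 - σ))
    (hht : E.ht Zt ≤ 2 * E.B₁₄ * (d : ℝ) ^ (1 + β - σ))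
    (hdeglt : 2 * E.A₁₄ * (d : ℝ) ^ (σ - 1) < (E.pts Zt).card)
    (hP17 : ∀ n : ℕ, 1 ≤ n → n ≤ ⌊(D : ℝ) ^ σ⌋₊ →
      ∃ ι : E.Pt → ℤ, (∀ b ∈ E.pts Zt, |ι b| < n) ∧
        ∑ b ∈ E.pts Zt, Real.log (E.dist b (E.γ (ι b))) ≤
          -(n * (E.κ / 4) * (D : ℝ) ^ (ν - β - 2) * ((D : ℝ) ^ β * (E.pts Zt).card + D * E.ht Zt))) :
    (D : ℝ) ^ (ν - 2) ≤ 16 * E.B₁₄ / (E.κ * E.A₁₄) * (d : ℝ) ^ (3 + β - 3 * σ) ∧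
      (d : ℝ) ^ (σ - 1) ≤ 8 / E.κ * (D : ℝ) ^ (1 + β - ν) := by
  classical
  have hκ := E.κ_pos
  have hA0 : 0 < E.A₁₄ := by linarith [E.one_le_A₁₄]
  have hB0 : 0 < E.B₁₄ := by linarith [E.one_le_B₁₄]
  have hdpos : (0 : ℝ) < d := by exact_mod_cast hd1
  have hdr : (1 : ℝ) ≤ d := by exact_mod_cast hd1
  have hdD' : (d : ℝ) ≤ D := by exact_mod_cast hdD.le
  have hDpos : (0 : ℝ) < D := by linarith
  have hcard1 : (1 : ℝ) ≤ (E.pts Zt).card := E.one_le_card _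
  set c : ℝ := ((E.pts Zt).card : ℝ) with hc_def
  set T : ℕ := ⌊(d : ℝ) ^ σ⌋₊ with hT
  have h1σ : (1 : ℝ) ≤ (d : ℝ) ^ σ := Real.one_le_rpow hdr (by linarith)
  have h1T : 1 ≤ T := Nat.le_floor (by exact_mod_cast h1σ)
  have hTσ : (T : ℝ) ≤ (d : ℝ) ^ σ := Nat.floor_le (by positivity)
  have hT2 : (d : ℝ) ^ σ / 2 ≤ T := by
    have i1 := Nat.lt_floor_add_one ((d : ℝ) ^ σ)
    have i2 : (1 : ℝ) ≤ T := by exact_mod_cast h1T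
    rw [← hT] at i1
    linarith
  have hTD : T ≤ ⌊(D : ℝ) ^ σ⌋₊ :=
    Nat.floor_mono (Real.rpow_le_rpow hdpos.le hdD' (by linarith))
  have hT1r : (0 : ℝ) ≤ (T : ℝ) - 1 := by
    have : (1 : ℝ) ≤ T := by exact_mod_cast h1T
    linarith
  have habsT : |(((T : ℤ) - 1 : ℤ) : ℝ)| = (T : ℝ) - 1 := by
    push_cast; exact abs_of_nonneg hT1r
  -- `Z := τ^{T-1} Z̃_D ⊄ W_d`
  have hnot : ¬ E.IsIn (E.τV ((T : ℤ) - 1) Zt) d := by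
    refine E.not_isIn_of_crit hd0 hcrit ?_
    rw [habsT]
    have : (0 : ℝ) ≤ T := by positivity
    linarith
  obtain ⟨j, hj0, hj2, v, hvpos, hL, hU⟩ := E.notIn d hd0 _ hnot
  obtain ⟨ι, hι, hS⟩ := hP17 T h1T hTD
  have hcardZ : (E.pts (E.τV ((T : ℤ) - 1) Zt)).card = (E.pts Zt).card := E.card_pts_τV _ _
  have hhtZ : E.ht (E.τV ((T : ℤ) - 1) Zt) ≤ E.ht Zt + E.c₄ * (d : ℝ) ^ σ * c := by
    have h := E.ht_τV_le ((T : ℤ) - 1) Zt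
    rw [habsT] at h
    have : E.c₄ * ((T : ℝ) - 1) * c ≤ E.c₄ * (d : ℝ) ^ σ * c := by
      apply mul_le_mul_of_nonneg_right _ (by positivity)
      exact mul_le_mul_of_nonneg_left (by linarith) E.c₄_nonneg
    linarith
  rw [hcardZ, E.sum_pts_τV] at hL
  -- pointwise upper bound (6.5) ⇒ (6.6)
  have hvpos' : ∀ b ∈ E.pts Zt, 0 < v (E.τ ((T : ℤ) - 1) b) := fun b hb =>
    hvpos _ (E.τ_mem_pts_τV _ _ hb)
  have hU' : ∀ b ∈ E.pts Zt, v (E.τ ((T : ℤ) - 1) b) ≤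
      Real.exp (-(d : ℝ) ^ ν / 2) + Real.exp (3 * (d : ℝ) ^ β) * E.dist b (E.γ (ι b)) := by
    intro b hb
    have hbZ : E.τ ((T : ℤ) - 1) b ∈ E.pts (E.τV ((T : ℤ) - 1) Zt) := E.τ_mem_pts_τV _ _ hb
    have hιb := abs_lt.mp (hι b hb)
    have hk0 : 0 ≤ j + (ι b + ((T : ℤ) - 1)) := by omega
    have hk4 : j + (ι b + ((T : ℤ) - 1)) < 4 * (T : ℕ) := by omega
    have hu := hU _ hbZ (ι b + ((T : ℤ) - 1)) hk0 hk4
    have hγ : E.γ (ι b + ((T : ℤ) - 1)) = E.τ ((T : ℤ) - 1) (E.γ (ι b)) := by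
      rw [E.τ_γ]; ring_nf
    have hdist : E.dist (E.τ ((T : ℤ) - 1) b) (E.γ (ι b + ((T : ℤ) - 1))) ≤
        Real.exp (E.c₁ * (d : ℝ) ^ σ) * E.dist b (E.γ (ι b)) := by
      rw [hγ]
      refine le_trans (E.dist_τ_le _ _ _) (mul_le_mul_of_nonneg_right ?_ (E.dist_nonneg _ _))
      apply Real.exp_le_exp.mpr
      rw [habsT]
      exact mul_le_mul_of_nonneg_left (by linarith) E.c₁_nonneg
    have hnn : (0 : ℝ) ≤ ((d : ℝ) + 2) ^ 3 * Real.exp (2 * (d : ℝ) ^ β) := by positivity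
    calc v (E.τ ((T : ℤ) - 1) b)
        ≤ Real.exp (-(d : ℝ) ^ ν / 2) + ((d : ℝ) + 2) ^ 3 * Real.exp (2 * (d : ℝ) ^ β) *
            E.dist (E.τ ((T : ℤ) - 1) b) (E.γ (ι b + ((T : ℤ) - 1))) := hu
      _ ≤ Real.exp (-(d : ℝ) ^ ν / 2) + ((d : ℝ) + 2) ^ 3 * Real.exp (2 * (d : ℝ) ^ β) *
            (Real.exp (E.c₁ * (d : ℝ) ^ σ) * E.dist b (E.γ (ι b))) := by
          gcongr
      _ = Real.exp (-(d : ℝ) ^ ν / 2) + (((d : ℝ) + 2) ^ 3 * Real.exp (2 * (d : ℝ) ^ β) *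
            Real.exp (E.c₁ * (d : ℝ) ^ σ)) * E.dist b (E.γ (ι b)) := by ring
      _ ≤ Real.exp (-(d : ℝ) ^ ν / 2) + Real.exp (3 * (d : ℝ) ^ β) * E.dist b (E.γ (ι b)) := by
          gcongr
          exact E.dist_nonneg _ _
  set G : ℝ := Real.exp (3 * (d : ℝ) ^ β) with hG
  set e₀ : ℝ := Real.exp (-(d : ℝ) ^ ν / 2) with he₀
  have hGpos : 0 < G := Real.exp_pos _
  have he₀pos : 0 < e₀ := Real.exp_pos _
  have hG1 : 1 ≤ G := by
    rw [hG]; apply Real.one_le_exp; positivity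
  have he₀1 : e₀ ≤ 1 := by
    rw [he₀]; apply Real.exp_le_one_iff.mpr
    have : 0 ≤ (d : ℝ) ^ ν := by positivity
    linarith
  have hlog2 : (0 : ℝ) ≤ Real.log 2 := Real.log_nonneg (by norm_num)
  have hlog3 : (0 : ℝ) ≤ Real.log 3 := Real.log_nonneg (by norm_num)
  have hβpos : (0 : ℝ) ≤ (d : ℝ) ^ β := by positivity
  have hd1σ : (d : ℝ) * (d : ℝ) ^ σ = (d : ℝ) ^ (1 + σ) := by
    rw [Real.rpow_add hdpos, Real.rpow_one]
  by_cases hsub : ∃ b ∈ E.pts Zt, G * E.dist b (E.γ (ι b)) ≤ e₀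
  · -- sub-case (i): absurd for `d` large
    exfalso
    obtain ⟨b₀, hb₀, hsmall⟩ := hsub
    have hv0 : Real.log (v (E.τ ((T : ℤ) - 1) b₀)) ≤ Real.log 2 + -(d : ℝ) ^ ν / 2 := by
      have h := hU' b₀ hb₀
      have h2 : v (E.τ ((T : ℤ) - 1) b₀) ≤ 2 * e₀ := by linarith
      calc Real.log (v (E.τ ((T : ℤ) - 1) b₀)) ≤ Real.log (2 * e₀) :=
            Real.log_le_log (hvpos' _ hb₀) h2
        _ = Real.log 2 + -(d : ℝ) ^ ν / 2 := by
            rw [Real.log_mul two_ne_zero he₀pos.ne', he₀, Real.log_exp]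
    have hvall : ∀ b ∈ E.pts Zt, Real.log (v (E.τ ((T : ℤ) - 1) b)) ≤
        Real.log 3 + 3 * (d : ℝ) ^ β := by
      intro b hb
      have h := hU' b hb
      have hdb : E.dist b (E.γ (ι b)) ≤ 2 := E.dist_le_two _ _
      have h3 : v (E.τ ((T : ℤ) - 1) b) ≤ 3 * G := by
        have : G * E.dist b (E.γ (ι b)) ≤ G * 2 := mul_le_mul_of_nonneg_left hdb hGpos.le
        linarith
      calc Real.log (v (E.τ ((T : ℤ) - 1) b)) ≤ Real.log (3 * G) :=
            Real.log_le_log (hvpos' _ hb) h3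
        _ = Real.log 3 + 3 * (d : ℝ) ^ β := by
            rw [Real.log_mul three_ne_zero hGpos.ne', hG, Real.log_exp]
    have hsum : ∑ b ∈ E.pts Zt, Real.log (v (E.τ ((T : ℤ) - 1) b)) ≤
        Real.log 2 - (d : ℝ) ^ ν / 2 + c * (Real.log 3 + 3 * (d : ℝ) ^ β) := by
      rw [← Finset.add_sum_erase _ _ hb₀]
      have h1 : ∑ b ∈ (E.pts Zt).erase b₀, Real.log (v (E.τ ((T : ℤ) - 1) b)) ≤
          ∑ _b ∈ (E.pts Zt).erase b₀, (Real.log 3 + 3 * (d : ℝ) ^ β) :=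
        Finset.sum_le_sum fun b hb => hvall b (Finset.mem_of_mem_erase hb)
      rw [Finset.sum_const, nsmul_eq_mul] at h1
      have h2 : ((((E.pts Zt).erase b₀).card : ℕ) : ℝ) ≤ c := by
        rw [hc_def]; exact_mod_cast Finset.card_erase_le
      have h3 : (0 : ℝ) ≤ Real.log 3 + 3 * (d : ℝ) ^ β := by positivity
      have h4 := mul_le_mul_of_nonneg_right h2 h3
      linarith [hv0, h1, h4]
    have hfin := hN₂ c (E.ht Zt) (by positivity) hdeg (E.ht_nonneg _) hht
    -- `hL : -(c₇ d c + d ht Z) ≤ ∑`, `hhtZ`, `hsum` contradict `hfin`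
    have h5 : (d : ℝ) * E.ht (E.τV ((T : ℤ) - 1) Zt) ≤
        d * E.ht Zt + E.c₄ * (d : ℝ) ^ (1 + σ) * c := by
      have := mul_le_mul_of_nonneg_left hhtZ hdpos.le
      rw [← hd1σ]
      linarith [this, show (d : ℝ) * (E.ht Zt + E.c₄ * (d : ℝ) ^ σ * c) =
        d * E.ht Zt + E.c₄ * (d * (d : ℝ) ^ σ) * c by ring]
    have h6 : c * (Real.log 3 + 3 * (d : ℝ) ^ β + E.c₇ * d + E.c₄ * (d : ℝ) ^ (1 + σ)) =
        c * (Real.log 3 + 3 * (d : ℝ) ^ β) + E.c₇ * d * c + E.c₄ * (d : ℝ) ^ (1 + σ) * c := by ring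
    linarith [hL, hsum, h5, h6, hfin]
  · -- sub-case (ii)
    push Not at hsub
    have hvall : ∀ b ∈ E.pts Zt, Real.log (v (E.τ ((T : ℤ) - 1) b)) ≤
        Real.log 2 + 3 * (d : ℝ) ^ β + Real.log (E.dist b (E.γ (ι b))) := by
      intro b hb
      have h := hU' b hb
      have hs := hsub b hb
      have hdbpos : 0 < E.dist b (E.γ (ι b)) := E.dist_γ_pos Zt b hb _
      have h2 : v (E.τ ((T : ℤ) - 1) b) ≤ 2 * (G * E.dist b (E.γ (ι b))) := by linarith
      calc Real.log (v (E.τ ((T : ℤ) - 1) b)) ≤ Real.log (2 * (G * E.dist b (E.γ (ι b)))) :=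
            Real.log_le_log (hvpos' _ hb) h2
        _ = Real.log 2 + 3 * (d : ℝ) ^ β + Real.log (E.dist b (E.γ (ι b))) := by
            rw [Real.log_mul two_ne_zero (mul_pos hGpos hdbpos).ne',
              Real.log_mul hGpos.ne' hdbpos.ne', hG, Real.log_exp]
            ring
    have hsum : ∑ b ∈ E.pts Zt, Real.log (v (E.τ ((T : ℤ) - 1) b)) ≤
        c * (Real.log 2 + 3 * (d : ℝ) ^ β) + ∑ b ∈ E.pts Zt, Real.log (E.dist b (E.γ (ι b))) := by
      calc ∑ b ∈ E.pts Zt, Real.log (v (E.τ ((T : ℤ) - 1) b))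
          ≤ ∑ b ∈ E.pts Zt, (Real.log 2 + 3 * (d : ℝ) ^ β + Real.log (E.dist b (E.γ (ι b)))) :=
            Finset.sum_le_sum hvall
        _ = c * (Real.log 2 + 3 * (d : ℝ) ^ β) +
            ∑ b ∈ E.pts Zt, Real.log (E.dist b (E.γ (ι b))) := by
            rw [Finset.sum_add_distrib, Finset.sum_const, nsmul_eq_mul]
    -- notation for the powers of `D`
    have hPQ : (D : ℝ) ^ (ν - β - 2) * (D : ℝ) ^ β = (D : ℝ) ^ (ν - 2) := by
      rw [← Real.rpow_add hDpos]; ring_nf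
    have hPD : (D : ℝ) ^ (ν - β - 2) * D = (D : ℝ) ^ (ν - β - 1) := by
      rw [mul_comm]
      nth_rewrite 1 [← Real.rpow_one (D : ℝ)]
      rw [← Real.rpow_add hDpos]; ring_nf
    set X : ℝ := (D : ℝ) ^ (ν - 2) with hX
    set Y : ℝ := (D : ℝ) ^ (ν - β - 1) with hY
    have hXpos : 0 < X := Real.rpow_pos_of_pos hDpos _
    have hYpos : 0 < Y := Real.rpow_pos_of_pos hDpos _
    have hS' : ∑ b ∈ E.pts Zt, Real.log (E.dist b (E.γ (ι b))) ≤
        -(T * (E.κ / 4) * X * c) - T * (E.κ / 4) * Y * E.ht Zt := by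
      have e : (T : ℝ) * (E.κ / 4) * (D : ℝ) ^ (ν - β - 2) * ((D : ℝ) ^ β * c + D * E.ht Zt) =
          T * (E.κ / 4) * X * c + T * (E.κ / 4) * Y * E.ht Zt := by
        rw [← hPQ, ← hPD]; ring
      rw [e] at hS
      linarith
    -- (1): `T(κ/4) X c + T(κ/4) Y h ≤ c R + d h`
    set h : ℝ := E.ht Zt with hh_def
    have hh0 : 0 ≤ h := E.ht_nonneg _
    set R : ℝ := Real.log 2 + 3 * (d : ℝ) ^ β + E.c₇ * d + E.c₄ * (d : ℝ) ^ (1 + σ) with hR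
    have h1 : (T : ℝ) * (E.κ / 4) * X * c + T * (E.κ / 4) * Y * h ≤ c * R + d * h := by
      have h5 : (d : ℝ) * E.ht (E.τV ((T : ℤ) - 1) Zt) ≤ d * h + E.c₄ * (d : ℝ) ^ (1 + σ) * c := by
        have := mul_le_mul_of_nonneg_left hhtZ hdpos.le
        rw [← hd1σ]
        linarith [this, show (d : ℝ) * (h + E.c₄ * (d : ℝ) ^ σ * c) =
          d * h + E.c₄ * (d * (d : ℝ) ^ σ) * c by ring]
      have h6 : c * R = c * (Real.log 2 + 3 * (d : ℝ) ^ β) + E.c₇ * d * c +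
          E.c₄ * (d : ℝ) ^ (1 + σ) * c := by rw [hR]; ring
      linarith [hL, hsum, hS', h5, h6]
    -- (2): replace `T` by `d^σ / 2`
    have hdσ : 0 < (d : ℝ) ^ σ := by positivity
    have hTκ : E.κ / 8 * (d : ℝ) ^ σ ≤ T * (E.κ / 4) := by
      have := mul_le_mul_of_nonneg_left hT2 (by positivity : (0 : ℝ) ≤ E.κ / 4)
      linarith
    have h2 : E.κ / 8 * (d : ℝ) ^ σ * X * c + E.κ / 8 * (d : ℝ) ^ σ * Y * h ≤ c * R + d * h := by
      have i1 : E.κ / 8 * (d : ℝ) ^ σ * X * c ≤ T * (E.κ / 4) * X * c :=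
        mul_le_mul_of_nonneg_right (mul_le_mul_of_nonneg_right hTκ hXpos.le) (by positivity)
      have i2 : E.κ / 8 * (d : ℝ) ^ σ * Y * h ≤ T * (E.κ / 4) * Y * h :=
        mul_le_mul_of_nonneg_right (mul_le_mul_of_nonneg_right hTκ hYpos.le) hh0
      linarith
    -- (★): `R ≤ (κ/16) d^σ X`
    have hR' : R ≤ E.κ / 16 * (d : ℝ) ^ σ * X := by
      have e : (d : ℝ) ^ (σ + ν - 2) = (d : ℝ) ^ σ * (d : ℝ) ^ (ν - 2) := by
        rw [← Real.rpow_add hdpos]; ring_nf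
      have hx : (d : ℝ) ^ (ν - 2) ≤ X := Real.rpow_le_rpow hdpos.le hdD' (by linarith)
      calc R ≤ E.κ / 16 * (d : ℝ) ^ (σ + ν - 2) := hN₃
        _ = E.κ / 16 * (d : ℝ) ^ σ * (d : ℝ) ^ (ν - 2) := by rw [e]; ring
        _ ≤ E.κ / 16 * (d : ℝ) ^ σ * X :=
            mul_le_mul_of_nonneg_left hx (by positivity)
    have hstar : E.κ / 16 * (d : ℝ) ^ σ * X * c + E.κ / 8 * (d : ℝ) ^ σ * Y * h ≤ d * h := by
      have := mul_le_mul_of_nonneg_left hR' (by positivity : (0 : ℝ) ≤ c)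
      linarith
    -- `h > 0`
    have hterm1 : 0 < E.κ / 16 * (d : ℝ) ^ σ * X * c := by positivity
    have hterm2 : 0 ≤ E.κ / 8 * (d : ℝ) ^ σ * Y * h := by positivity
    have hhpos : 0 < h := by
      by_contra hcon
      have : h = 0 := le_antisymm (not_lt.mp hcon) hh0
      rw [this] at hstar
      linarith
    constructor
    · -- (I): `X ≤ (16 B/(κ A)) d^{3+β-3σ}`
      have i1 : E.κ / 16 * (d : ℝ) ^ σ * X * c ≤ d * h := by linarith
      have i2 : (d : ℝ) * h ≤ 2 * E.B₁₄ * (d : ℝ) ^ (2 + β - σ) := by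
        have := mul_le_mul_of_nonneg_left hht hdpos.le
        have e : (d : ℝ) * (2 * E.B₁₄ * (d : ℝ) ^ (1 + β - σ)) =
            2 * E.B₁₄ * (d : ℝ) ^ (2 + β - σ) := by
          rw [show 2 + β - σ = 1 + (1 + β - σ) by ring, Real.rpow_add hdpos, Real.rpow_one]; ring
        linarith
      have i3 : E.κ / 16 * (d : ℝ) ^ σ * X * (2 * E.A₁₄ * (d : ℝ) ^ (σ - 1)) ≤
          E.κ / 16 * (d : ℝ) ^ σ * X * c :=
        mul_le_mul_of_nonneg_left hdeglt.le (by positivity)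
      -- combine: `X * ((κ A / 8) d^{2σ-1}) ≤ 2B d^{2+β-σ}`
      have e1 : (d : ℝ) ^ σ * (d : ℝ) ^ (σ - 1) = (d : ℝ) ^ (2 * σ - 1) := by
        rw [← Real.rpow_add hdpos]; ring_nf
      have i4 : X * (E.κ * E.A₁₄ / 8 * (d : ℝ) ^ (2 * σ - 1)) ≤
          2 * E.B₁₄ * (d : ℝ) ^ (2 + β - σ) := by
        have : E.κ / 16 * (d : ℝ) ^ σ * X * (2 * E.A₁₄ * (d : ℝ) ^ (σ - 1)) =
            X * (E.κ * E.A₁₄ / 8 * (d : ℝ) ^ (2 * σ - 1)) := by rw [← e1]; ring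
        linarith
      have hfac : 0 < E.κ * E.A₁₄ / 8 * (d : ℝ) ^ (2 * σ - 1) := by positivity
      rw [← le_div_iff₀ hfac] at i4
      refine i4.trans (le_of_eq ?_)
      have e2 : (d : ℝ) ^ (2 + β - σ) = (d : ℝ) ^ (3 + β - 3 * σ) * (d : ℝ) ^ (2 * σ - 1) := by
        rw [← Real.rpow_add hdpos]; ring_nf
      rw [e2]
      have hne : (d : ℝ) ^ (2 * σ - 1) ≠ 0 := (Real.rpow_pos_of_pos hdpos _).ne'
      field_simp
      norm_num
    · -- (II): `d^{σ-1} ≤ (8/κ) D^{1+β-ν}`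
      have i1 : E.κ / 8 * (d : ℝ) ^ σ * Y * h ≤ d * h := by linarith
      have i2 : E.κ / 8 * (d : ℝ) ^ σ * Y ≤ d := le_of_mul_le_mul_right (by linarith) hhpos
      have e1 : (d : ℝ) ^ σ = (d : ℝ) ^ (σ - 1) * d := by
        nth_rewrite 3 [← Real.rpow_one (d : ℝ)]
        rw [← Real.rpow_add hdpos]; ring_nf
      have e2 : Y * (D : ℝ) ^ (1 + β - ν) = 1 := by
        rw [hY, ← Real.rpow_add hDpos, show ν - β - 1 + (1 + β - ν) = 0 by ring, Real.rpow_zero]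
      have hZpos : 0 < (D : ℝ) ^ (1 + β - ν) := Real.rpow_pos_of_pos hDpos _
      -- from `i2`: `(κ/8) d^{σ-1} Y ≤ 1`
      have i3 : E.κ / 8 * (d : ℝ) ^ (σ - 1) * Y ≤ 1 := by
        rw [e1] at i2
        have : (E.κ / 8 * (d : ℝ) ^ (σ - 1) * Y) * d ≤ 1 * d := by
          linarith [i2, show E.κ / 8 * ((d : ℝ) ^ (σ - 1) * d) * Y =
            E.κ / 8 * (d : ℝ) ^ (σ - 1) * Y * d by ring]
        exact le_of_mul_le_mul_right this hdpos
      have i4 := mul_le_mul_of_nonneg_right i3 hZpos.le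
      rw [one_mul, mul_assoc, e2, mul_one] at i4
      -- `i4 : κ/8 * d^{σ-1} ≤ D^{1+β-ν}`
      rw [div_mul_eq_mul_div, div_le_iff₀ (by norm_num : (0 : ℝ) < 8)] at i4
      rw [div_mul_eq_mul_div, le_div_iff₀ hκ]
      linarith

/-! ### §6, Case 1 -/

/-- **Case 1 of §6** (levels `D ≥ d = D*`, with `deg Z̃_D, deg Z̃_{D*} ≤ 2A₁₄ d^{σ−1}` and the
bounds (6.3) at both levels): absurd for `d` large. Proof as printed: Corollary 18 at both levels
with `T* = ⌊d^σ⌋` gives points `α ∈ Z̃_D`, `α* ∈ Z̃_{D*}` with `dist(τ^{-i}α, γ₀)`,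
`dist(τ^{-j}α*, γ₀) ≤ e^{c₁T*} e^{−T*(κ/4) d^{ν−2}}` (Lemma 5), whence
`dist(τ^{-i}α, τ^{-j}α*) ≤ 4 e^{c₁ d^σ − (κ/8) d^{ν+σ−2}}`; but `τ^{-i}α ≠ τ^{-j}α*` by (6.2),
their degrees are `≤ 2A₁₄ d^{σ−1}` and their heights `≤ (2B₁₄ + 2A₁₄c₄) d^{1+β−σ}` (Lemma 11), so
Proposition 12 bounds that distance below by `exp(−c₁₂(2A₁₄)² d^{2σ−2} − 4A₁₄(2B₁₄+2A₁₄c₄) d^β)`,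
contradicting `case1_eventually`. [cite: NguyenRoy2016, §6, Case 1] -/
theorem case1_core (hσ1 : 1 ≤ σ) (hβ : σ + 1 < β) (hν : 2 + β - σ < ν)
    {D d : ℕ} {Zt Zs : E.V} (hd1 : 1 ≤ d) (hdD : d ≤ D)
    (hN₁ : Real.log 4 + E.c₁ * (d : ℝ) ^ σ + E.c₁₂ * (2 * E.A₁₄) ^ 2 * (d : ℝ) ^ (2 * σ - 2) +
      2 * (2 * E.A₁₄) * (2 * E.B₁₄ + 2 * E.A₁₄ * E.c₄) * (d : ℝ) ^ β <
        E.κ / 8 * (d : ℝ) ^ (ν + σ - 2))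
    (hdegT : ((E.pts Zt).card : ℝ) ≤ 2 * E.A₁₄ * (d : ℝ) ^ (σ - 1))
    (hdegS : ((E.pts Zs).card : ℝ) ≤ 2 * E.A₁₄ * (d : ℝ) ^ (σ - 1))
    (hdegT' : ((E.pts Zt).card : ℝ) ≤ 2 * E.A₁₄ * (d : ℝ) ^ (2 - σ))
    (hdegS' : ((E.pts Zs).card : ℝ) ≤ 2 * E.A₁₄ * (d : ℝ) ^ (2 - σ))
    (hhtT : E.ht Zt ≤ 2 * E.B₁₄ * (d : ℝ) ^ (1 + β - σ))
    (hhtS : E.ht Zs ≤ 2 * E.B₁₄ * (d : ℝ) ^ (1 + β - σ))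
    (hne : ∀ i j : ℤ, |(i : ℝ)| < ⌊(d : ℝ) ^ σ⌋₊ → |(j : ℝ)| < ⌊(d : ℝ) ^ σ⌋₊ →
      ∀ b ∈ E.pts (E.τV i Zt), ∀ b' ∈ E.pts (E.τV j Zs), b ≠ b')
    (hPT : ∀ n : ℕ, 1 ≤ n → n ≤ ⌊(D : ℝ) ^ σ⌋₊ →
      ∃ ι : E.Pt → ℤ, (∀ b ∈ E.pts Zt, |ι b| < n) ∧
        ∑ b ∈ E.pts Zt, Real.log (E.dist b (E.γ (ι b))) ≤
          -(n * (E.κ / 4) * (D : ℝ) ^ (ν - β - 2) * ((D : ℝ) ^ β * (E.pts Zt).card + D * E.ht Zt)))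
    (hPS : ∀ n : ℕ, 1 ≤ n → n ≤ ⌊(d : ℝ) ^ σ⌋₊ →
      ∃ ι : E.Pt → ℤ, (∀ b ∈ E.pts Zs, |ι b| < n) ∧
        ∑ b ∈ E.pts Zs, Real.log (E.dist b (E.γ (ι b))) ≤
          -(n * (E.κ / 4) * (d : ℝ) ^ (ν - β - 2) * ((d : ℝ) ^ β * (E.pts Zs).card + d * E.ht Zs))) :
    False := by
  have hκ := E.κ_pos
  have hA0 : 0 < E.A₁₄ := by linarith [E.one_le_A₁₄]
  have hB0 : 0 < E.B₁₄ := by linarith [E.one_le_B₁₄]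
  have hc₄ := E.c₄_nonneg
  have hc₁₂ := E.c₁₂_nonneg
  have hdpos : (0 : ℝ) < d := by exact_mod_cast hd1
  have hdr : (1 : ℝ) ≤ d := by exact_mod_cast hd1
  have hdD' : (d : ℝ) ≤ D := by exact_mod_cast hdD
  have hD1 : 1 ≤ D := le_trans hd1 hdD
  set T : ℕ := ⌊(d : ℝ) ^ σ⌋₊ with hT
  have h1σ : (1 : ℝ) ≤ (d : ℝ) ^ σ := Real.one_le_rpow hdr (by linarith)
  have h1T : 1 ≤ T := Nat.le_floor (by exact_mod_cast h1σ)
  have hTσ : (T : ℝ) ≤ (d : ℝ) ^ σ := Nat.floor_le (by positivity)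
  have hT2 : (d : ℝ) ^ σ / 2 ≤ T := by
    have i1 := Nat.lt_floor_add_one ((d : ℝ) ^ σ)
    have i2 : (1 : ℝ) ≤ T := by exact_mod_cast h1T
    rw [← hT] at i1
    linarith
  have hTD : T ≤ ⌊(D : ℝ) ^ σ⌋₊ :=
    Nat.floor_mono (Real.rpow_le_rpow hdpos.le hdD' (by linarith))
  -- the two close points (Corollary 18 at levels `D` and `d`)
  obtain ⟨ι, hι, hs⟩ := hPT T h1T hTD
  obtain ⟨a, ha, hda⟩ := E.exists_close_point hD1 hs
  obtain ⟨ι', hι', hs'⟩ := hPS T h1T le_rfl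
  obtain ⟨a', ha', hda'⟩ := E.exists_close_point hd1 hs'
  have hi : |((ι a : ℤ) : ℝ)| < T := abs_cast_lt_of_abs_lt (hι a ha)
  have hj : |((ι' a' : ℤ) : ℝ)| < T := abs_cast_lt_of_abs_lt (hι' a' ha')
  have hb : E.τ (-ι a) a ∈ E.pts (E.τV (-ι a) Zt) := E.τ_mem_pts_τV _ _ ha
  have hb' : E.τ (-ι' a') a' ∈ E.pts (E.τV (-ι' a') Zs) := E.τ_mem_pts_τV _ _ ha'
  have hne' : E.τ (-ι a) a ≠ E.τ (-ι' a') a' :=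
    hne (-ι a) (-ι' a') (by push_cast; rw [abs_neg]; exact hi) (by push_cast; rw [abs_neg]; exact hj)
      _ hb _ hb'
  have hliou := E.liouville _ _ _ hb _ hb' hne'
  have hcT : ((E.pts (E.τV (-ι a) Zt)).card : ℝ) = (E.pts Zt).card := by
    exact_mod_cast E.card_pts_τV _ _
  have hcS : ((E.pts (E.τV (-ι' a') Zs)).card : ℝ) = (E.pts Zs).card := by
    exact_mod_cast E.card_pts_τV _ _
  rw [hcT, hcS] at hliou
  -- upper bound for the distance of the translated points
  set ε : ℝ := Real.exp (E.c₁ * (d : ℝ) ^ σ) *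
    Real.exp (-(T * (E.κ / 4) * (d : ℝ) ^ (ν - 2))) with hε
  have hεpos : 0 < ε := mul_pos (Real.exp_pos _) (Real.exp_pos _)
  have hclose : ∀ (k : ℤ) (x : E.Pt), |(k : ℝ)| < T →
      E.dist x (E.γ k) ≤ Real.exp (-(T * (E.κ / 4) * (d : ℝ) ^ (ν - 2))) →
      E.dist (E.τ (-k) x) (E.γ 0) ≤ ε := by
    intro k x hk hx
    have hγ : E.γ 0 = E.τ (-k) (E.γ k) := by rw [E.τ_γ, neg_add_cancel]
    rw [hγ]
    calc E.dist (E.τ (-k) x) (E.τ (-k) (E.γ k))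
        ≤ Real.exp (E.c₁ * |((-k : ℤ) : ℝ)|) * E.dist x (E.γ k) := E.dist_τ_le _ _ _
      _ ≤ ε := by
          apply mul_le_mul _ hx (E.dist_nonneg _ _) (Real.exp_pos _).le
          apply Real.exp_le_exp.mpr
          apply mul_le_mul_of_nonneg_left _ E.c₁_nonneg
          push_cast; rw [abs_neg]; linarith
  have hda2 : E.dist a (E.γ (ι a)) ≤ Real.exp (-(T * (E.κ / 4) * (d : ℝ) ^ (ν - 2))) := by
    refine hda.trans (Real.exp_le_exp.mpr ?_)
    have h1 : (d : ℝ) ^ (ν - 2) ≤ (D : ℝ) ^ (ν - 2) := Real.rpow_le_rpow hdpos.le hdD' (by linarith)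
    have h2 : (T : ℝ) * (E.κ / 4) * (d : ℝ) ^ (ν - 2) ≤ T * (E.κ / 4) * (D : ℝ) ^ (ν - 2) :=
      mul_le_mul_of_nonneg_left h1 (by positivity)
    linarith
  have h1 : E.dist (E.τ (-ι a) a) (E.γ 0) ≤ ε := hclose _ a hi hda2
  have h2 : E.dist (E.τ (-ι' a') a') (E.γ 0) ≤ ε := hclose _ a' hj hda'
  have hupper : E.dist (E.τ (-ι a) a) (E.τ (-ι' a') a') ≤ 4 * ε := by
    have := E.dist_triangle (E.τ (-ι a) a) (E.γ 0) (E.τ (-ι' a') a')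
    rw [E.dist_comm (E.γ 0)] at this
    linarith
  -- heights of the translates (Lemma 11)
  have e1 : (d : ℝ) ^ σ * (d : ℝ) ^ (2 - σ) = (d : ℝ) ^ (2 : ℝ) := by
    rw [← Real.rpow_add hdpos]; ring_nf
  have e2 : (d : ℝ) ^ (2 : ℝ) ≤ (d : ℝ) ^ (1 + β - σ) :=
    Real.rpow_le_rpow_of_exponent_le hdr (by linarith)
  have hheight : ∀ (k : ℤ) (W : E.V), |(k : ℝ)| < T →
      ((E.pts W).card : ℝ) ≤ 2 * E.A₁₄ * (d : ℝ) ^ (2 - σ) →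
      E.ht W ≤ 2 * E.B₁₄ * (d : ℝ) ^ (1 + β - σ) →
      E.ht (E.τV (-k) W) ≤ (2 * E.B₁₄ + 2 * E.A₁₄ * E.c₄) * (d : ℝ) ^ (1 + β - σ) := by
    intro k W hk hdW hhW
    have h := E.ht_τV_le (-k) W
    have hk' : |((-k : ℤ) : ℝ)| ≤ (d : ℝ) ^ σ := by push_cast; rw [abs_neg]; linarith
    have i1 : E.c₄ * |((-k : ℤ) : ℝ)| * ((E.pts W).card : ℝ) ≤
        E.c₄ * (d : ℝ) ^ σ * (2 * E.A₁₄ * (d : ℝ) ^ (2 - σ)) :=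
      mul_le_mul (mul_le_mul_of_nonneg_left hk' hc₄) hdW (by positivity) (by positivity)
    have i2 : E.c₄ * (d : ℝ) ^ σ * (2 * E.A₁₄ * (d : ℝ) ^ (2 - σ)) =
        2 * E.A₁₄ * E.c₄ * (d : ℝ) ^ (2 : ℝ) := by rw [← e1]; ring
    have i3 : 2 * E.A₁₄ * E.c₄ * (d : ℝ) ^ (2 : ℝ) ≤ 2 * E.A₁₄ * E.c₄ * (d : ℝ) ^ (1 + β - σ) :=
      mul_le_mul_of_nonneg_left e2 (by positivity)
    linarith
  have hhT := hheight (ι a) Zt hi hdegT' hhtT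
  have hhS := hheight (ι' a') Zs hj hdegS' hhtS
  -- the exponent of Proposition 12 is at most `Qb`
  set P₁ : ℝ := (d : ℝ) ^ (σ - 1) with hP₁
  set Pe : ℝ := (d : ℝ) ^ (1 + β - σ) with hPe
  set H : ℝ := 2 * E.B₁₄ + 2 * E.A₁₄ * E.c₄ with hH
  have hP₁0 : 0 ≤ P₁ := by positivity
  have hPe0 : 0 ≤ Pe := by positivity
  have hH0 : 0 ≤ H := by positivity
  set Qb : ℝ := E.c₁₂ * (2 * E.A₁₄ * P₁) * (2 * E.A₁₄ * P₁) + (2 * E.A₁₄ * P₁) * (H * Pe) +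
    (2 * E.A₁₄ * P₁) * (H * Pe) with hQb
  have hQ : E.c₁₂ * (E.pts Zt).card * (E.pts Zs).card + (E.pts Zt).card * E.ht (E.τV (-ι' a') Zs)
      + (E.pts Zs).card * E.ht (E.τV (-ι a) Zt) ≤ Qb := by
    have t1 : E.c₁₂ * (E.pts Zt).card * (E.pts Zs).card ≤ E.c₁₂ * (2 * E.A₁₄ * P₁) * (2 * E.A₁₄ * P₁) := by
      have := mul_le_mul hdegT hdegS (by positivity) (by positivity)
      have := mul_le_mul_of_nonneg_left this hc₁₂
      linarith [show E.c₁₂ * ((E.pts Zt).card : ℝ) * (E.pts Zs).card =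
        E.c₁₂ * (((E.pts Zt).card : ℝ) * (E.pts Zs).card) by ring,
        show E.c₁₂ * (2 * E.A₁₄ * P₁) * (2 * E.A₁₄ * P₁) =
          E.c₁₂ * ((2 * E.A₁₄ * P₁) * (2 * E.A₁₄ * P₁)) by ring]
    have t2 : ((E.pts Zt).card : ℝ) * E.ht (E.τV (-ι' a') Zs) ≤ (2 * E.A₁₄ * P₁) * (H * Pe) :=
      mul_le_mul hdegT hhS (E.ht_nonneg _) (by positivity)
    have t3 : ((E.pts Zs).card : ℝ) * E.ht (E.τV (-ι a) Zt) ≤ (2 * E.A₁₄ * P₁) * (H * Pe) :=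
      mul_le_mul hdegS hhT (E.ht_nonneg _) (by positivity)
    linarith
  -- take logarithms
  have hchain : Real.exp (-Qb) ≤ 4 * ε :=
    le_trans (Real.exp_le_exp.mpr (neg_le_neg hQ)) (hliou.trans hupper)
  have hlog : -Qb ≤ Real.log 4 + E.c₁ * (d : ℝ) ^ σ + -(T * (E.κ / 4) * (d : ℝ) ^ (ν - 2)) := by
    have := Real.log_le_log (Real.exp_pos _) hchain
    rwa [Real.log_exp, Real.log_mul (by norm_num) hεpos.ne', hε,
      Real.log_mul (Real.exp_pos _).ne' (Real.exp_pos _).ne', Real.log_exp, Real.log_exp,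
      ← add_assoc] at this
  have hTb : E.κ / 8 * (d : ℝ) ^ (ν + σ - 2) ≤ T * (E.κ / 4) * (d : ℝ) ^ (ν - 2) := by
    have e : (d : ℝ) ^ (ν + σ - 2) = (d : ℝ) ^ σ * (d : ℝ) ^ (ν - 2) := by
      rw [← Real.rpow_add hdpos]; ring_nf
    rw [e]
    have hTκ : E.κ / 8 * (d : ℝ) ^ σ ≤ T * (E.κ / 4) := by
      have := mul_le_mul_of_nonneg_left hT2 (by positivity : (0 : ℝ) ≤ E.κ / 4)
      linarith
    calc E.κ / 8 * ((d : ℝ) ^ σ * (d : ℝ) ^ (ν - 2)) = (E.κ / 8 * (d : ℝ) ^ σ) * (d : ℝ) ^ (ν - 2) := by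
          ring
      _ ≤ (T * (E.κ / 4)) * (d : ℝ) ^ (ν - 2) := mul_le_mul_of_nonneg_right hTκ (by positivity)
  have m1 : P₁ * P₁ = (d : ℝ) ^ (2 * σ - 2) := by rw [hP₁, ← Real.rpow_add hdpos]; ring_nf
  have m2 : P₁ * Pe = (d : ℝ) ^ β := by rw [hP₁, hPe, ← Real.rpow_add hdpos]; ring_nf
  have hQb' : Qb = E.c₁₂ * (2 * E.A₁₄) ^ 2 * (d : ℝ) ^ (2 * σ - 2) +
      2 * (2 * E.A₁₄) * H * (d : ℝ) ^ β := by
    rw [hQb, ← m1, ← m2]; ring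
  rw [hH] at hQb'
  linarith [hN₁, hlog, hTb, hQb']

/-! ### §6: the data are contradictory -/

include E in
/-- **§6 of Nguyen–Roy 2016, abstract form: an `EndgameData σ β ν` cannot exist** under the
constraints (1) of Theorem 1 on `σ, β, ν`. This is the printed proof of Theorem 1 from
Proposition 14, Corollary 16, Lemmas 5, 6, 11, Propositions 4, 12 and [R2012, Prop. 2.3] onwards:
Proposition 17 (`prop17`), the divergence of `max(deg Z̃_D, h(Z̃_D))`
(`eventually_lt_card_or_lt_ht`), the auxiliary level `D*` with (6.1)–(6.3) (`dstar`,
`ne_translates`, `bounds_self`), and the two cases (`case1_core` + `case1_eventually`;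
`case2_core` + `case_two_exponent_contradiction'`). Consequently Theorem 1 follows as soon as the
concrete objects of the paper are shown to form an `EndgameData` when `(ξ, η) ∉ ℚ̄ × ℚ̄`.
[cite: NguyenRoy2016, §6 (proof of Theorem 1)] -/
theorem false_of_constraints (hσ1 : 1 ≤ σ) (hσ2 : σ < 2) (hβ : σ + 1 < β)
    (hν1 : 3 / 2 ≤ σ → 2 + β - σ < ν)
    (hν2 : σ < 3 / 2 → 2 + β - σ + (σ - 1) * (3 - 2 * σ) / (2 + β - 2 * σ) < ν) : False := by
  classical
  have hν : 2 + β - σ < ν := two_add_sub_lt_nu hσ1 hβ hν1 hν2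
  have hν2' : 2 < ν := by linarith
  have hκ := E.κ_pos
  have hA0 : 0 < E.A₁₄ := by linarith [E.one_le_A₁₄]
  have hB0 : 0 < E.B₁₄ := by linarith [E.one_le_B₁₄]
  -- Proposition 17, in terms of `Z̃_D = E.zt mf D`
  obtain ⟨D₁, mf, h17⟩ := E.prop17' hσ1 hβ hν2'
  have h17' : ∀ D : ℕ, D₁ ≤ D → E.D₀ ≤ D ∧ mf D < ⌊(D : ℝ) ^ σ⌋₊ ∧
      ∀ n : ℕ, 1 ≤ n → n ≤ ⌊(D : ℝ) ^ σ⌋₊ →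
        ∃ ι : E.Pt → ℤ, (∀ b ∈ E.pts (E.zt mf D), |ι b| < n) ∧
          ∑ b ∈ E.pts (E.zt mf D), Real.log (E.dist b (E.γ (ι b))) ≤
            -(n * (E.κ / 4) * (D : ℝ) ^ (ν - β - 2) *
              ((D : ℝ) ^ β * (E.pts (E.zt mf D)).card + D * E.ht (E.zt mf D))) := h17
  -- divergence of `max(deg, ht)(Z̃_D)` (Corollary 19 + Proposition 12 + positivity)
  have hdiv : ∀ Bd : ℝ, ∀ᶠ D : ℕ in atTop,
      Bd < (E.pts (E.zt mf D)).card ∨ Bd < E.ht (E.zt mf D) := by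
    intro Bd
    refine E.eventually_lt_card_or_lt_ht (E.zt mf)
      (ε := fun D : ℕ => Real.exp (-((E.κ / 4) * (D : ℝ) ^ (ν - 2)))) ?_ ?_ Bd
    · have h1 : Tendsto (fun D : ℕ => (E.κ / 4) * (D : ℝ) ^ (ν - 2)) atTop atTop :=
        Tendsto.const_mul_atTop (by positivity)
          ((tendsto_rpow_atTop (by linarith)).comp tendsto_natCast_atTop_atTop)
      exact Real.tendsto_exp_neg_atTop_nhds_zero.comp h1
    · filter_upwards [eventually_ge_atTop (max D₁ 1)] with D hD
      obtain ⟨-, -, hP⟩ := h17' D (le_trans (le_max_left _ _) hD)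
      have hD1 : 1 ≤ D := le_trans (le_max_right _ _) hD
      have hDr : (1 : ℝ) ≤ D := by exact_mod_cast hD1
      have h1T : 1 ≤ ⌊(D : ℝ) ^ σ⌋₊ :=
        Nat.le_floor (by exact_mod_cast Real.one_le_rpow hDr (by linarith))
      obtain ⟨ι, hι, hs⟩ := hP 1 le_rfl h1T
      obtain ⟨b, hb, hle⟩ := E.exists_close_point hD1 hs
      have hι0 : ι b = 0 := by
        have := abs_lt.mp (hι b hb)
        omega
      refine ⟨b, hb, ?_⟩
      rw [hι0] at hle
      refine hle.trans (le_of_eq ?_)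
      push_cast
      ring_nf
  -- `D* → ∞`
  have hbig : ∀ M : ℕ, ∃ D₃ : ℕ, ∀ D : ℕ, D₃ ≤ D → M ≤ E.dstar mf D := by
    intro M
    obtain ⟨D₃, hD₃⟩ := Filter.eventually_atTop.mp
      (hdiv (max (E.A₁₄ * (M : ℝ) ^ (2 - σ)) (E.B₁₄ * (M : ℝ) ^ (1 + β - σ))))
    refine ⟨max D₃ M, fun D hD => E.le_dstar mf (le_trans (le_max_right _ _) hD) ?_⟩
    rcases hD₃ D (le_trans (le_max_left _ _) hD) with h | h
    · exact Or.inl (lt_of_le_of_lt (le_max_left _ _) h)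
    · exact Or.inr (lt_of_le_of_lt (le_max_right _ _) h)
  -- thresholds
  obtain ⟨N₁, hN₁⟩ := Filter.eventually_atTop.mp (case1_eventually (c := E.c₁)
    (p := E.c₁₂ * (2 * E.A₁₄) ^ 2) (q := 2 * (2 * E.A₁₄) * (2 * E.B₁₄ + 2 * E.A₁₄ * E.c₄))
    E.κ_pos hσ1 hσ2 hβ hν)
  obtain ⟨N₂, hN₂⟩ := Filter.eventually_atTop.mp (case2i_eventually (A := E.A₁₄) (B := E.B₁₄)
    (ν := ν) E.c₇_nonneg E.c₄_nonneg hσ1 hβ hν)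
  obtain ⟨N₃, hN₃⟩ := Filter.eventually_atTop.mp (case2ii_eventually (c₇ := E.c₇) (c₄ := E.c₄)
    E.κ_pos hσ1 hβ hν)
  obtain ⟨N₄, hN₄⟩ := Filter.eventually_atTop.mp (coeff_eventually (c₁ := E.c₁) hσ1 hβ)
  set N₅ : ℕ := ⌈(1 + β - σ) / Real.log 2⌉₊ with hN₅
  set N₀ : ℕ := D₁ + 1 + N₁ + N₂ + N₃ + N₄ + N₅ with hN₀
  -- (6.1) holds at level `N₀` for `D ≥ D₂`
  obtain ⟨D₂, hD₂⟩ := Filter.eventually_atTop.mp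
    (hdiv (max (E.A₁₄ * (N₀ : ℝ) ^ (2 - σ)) (E.B₁₄ * (N₀ : ℝ) ^ (1 + β - σ))))
  -- the regime: for `D ≥ D₂ + N₀ + 1`, `d = D*` satisfies `N₀ ≤ d < D`, (6.1) and (6.3)
  have regime : ∀ D : ℕ, D₂ + N₀ + 1 ≤ D →
      N₀ ≤ E.dstar mf D ∧ E.dstar mf D < D ∧
      (E.A₁₄ * (E.dstar mf D : ℝ) ^ (2 - σ) < (E.pts (E.zt mf D)).card ∨
        E.B₁₄ * (E.dstar mf D : ℝ) ^ (1 + β - σ) < E.ht (E.zt mf D)) ∧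
      ((E.pts (E.zt mf D)).card : ℝ) ≤ 2 * E.A₁₄ * (E.dstar mf D : ℝ) ^ (2 - σ) ∧
      E.ht (E.zt mf D) ≤ 2 * E.B₁₄ * (E.dstar mf D : ℝ) ^ (1 + β - σ) := by
    intro D hD
    have h1' : N₀ ≤ D := by omega
    have hcritN₀ : E.A₁₄ * (N₀ : ℝ) ^ (2 - σ) < (E.pts (E.zt mf D)).card ∨
        E.B₁₄ * (N₀ : ℝ) ^ (1 + β - σ) < E.ht (E.zt mf D) := by
      rcases hD₂ D (by omega) with h | h
      · exact Or.inl (lt_of_le_of_lt (le_max_left _ _) h)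
      · exact Or.inr (lt_of_le_of_lt (le_max_right _ _) h)
    have h1 : N₀ ≤ E.dstar mf D := E.le_dstar mf h1' hcritN₀
    have h2 := E.dstar_spec mf h1' hcritN₀
    obtain ⟨hD0, hm, -⟩ := h17' D (by omega)
    have hself := E.bounds_self hD0 hm
    change ((E.pts (E.zt mf D)).card : ℝ) ≤ _ ∧ E.ht (E.zt mf D) ≤ _ at hself
    have h3 : E.dstar mf D < D := by
      rcases (E.dstar_le mf D).lt_or_eq with h | h
      · exact h
      · exfalso
        rw [h] at h2
        rcases h2 with h2 | h2 <;> linarith [hself.1, hself.2]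
    have h4 := E.not_crit_dstar_succ mf (show E.dstar mf D + 1 ≤ D by omega)
    push_cast at h4
    push Not at h4
    have hd1 : (1 : ℝ) ≤ E.dstar mf D := by exact_mod_cast (show 1 ≤ E.dstar mf D by omega)
    have hdN₅ : (1 + β - σ) / Real.log 2 ≤ (E.dstar mf D : ℝ) :=
      le_trans (Nat.le_ceil _) (by exact_mod_cast (show N₅ ≤ E.dstar mf D by omega))
    have hlog2 : 0 < Real.log 2 := Real.log_pos (by norm_num)
    have e1 : ((E.dstar mf D : ℝ) + 1) ^ (2 - σ) ≤ 2 * (E.dstar mf D : ℝ) ^ (2 - σ) :=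
      add_one_rpow_le_two_mul_rpow (by linarith) hd1
        (le_trans (div_le_div_of_nonneg_right (by linarith) hlog2.le) hdN₅)
    have e2 : ((E.dstar mf D : ℝ) + 1) ^ (1 + β - σ) ≤ 2 * (E.dstar mf D : ℝ) ^ (1 + β - σ) :=
      add_one_rpow_le_two_mul_rpow (by linarith) hd1 hdN₅
    refine ⟨h1, h3, h2, ?_, ?_⟩
    · calc ((E.pts (E.zt mf D)).card : ℝ) ≤ E.A₁₄ * ((E.dstar mf D : ℝ) + 1) ^ (2 - σ) := h4.1
        _ ≤ E.A₁₄ * (2 * (E.dstar mf D : ℝ) ^ (2 - σ)) := mul_le_mul_of_nonneg_left e1 hA0.le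
        _ = 2 * E.A₁₄ * (E.dstar mf D : ℝ) ^ (2 - σ) := by ring
    · calc E.ht (E.zt mf D) ≤ E.B₁₄ * ((E.dstar mf D : ℝ) + 1) ^ (1 + β - σ) := h4.2
        _ ≤ E.B₁₄ * (2 * (E.dstar mf D : ℝ) ^ (1 + β - σ)) := mul_le_mul_of_nonneg_left e2 hB0.le
        _ = 2 * E.B₁₄ * (E.dstar mf D : ℝ) ^ (1 + β - σ) := by ring
  -- Case distinction on `deg Z̃_D` versus `2A (D*)^{σ-1}`
  by_cases hC2 : ∀ N : ℕ, ∃ D : ℕ, N ≤ D ∧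
      2 * E.A₁₄ * (E.dstar mf D : ℝ) ^ (σ - 1) < (E.pts (E.zt mf D)).card
  · -- Case 2 (arbitrarily large `D` with `deg Z̃_D > 2A (D*)^{σ-1}`)
    have hσ32 : σ < 3 / 2 := by
      by_contra hge
      push Not at hge
      obtain ⟨D, hD, hlt⟩ := hC2 (D₂ + N₀ + 1)
      obtain ⟨hN, -, -, hdeg, -⟩ := regime D hD
      have hd1 : (1 : ℝ) ≤ E.dstar mf D := by exact_mod_cast (show 1 ≤ E.dstar mf D by omega)
      have h1 : (E.dstar mf D : ℝ) ^ (2 - σ) ≤ (E.dstar mf D : ℝ) ^ (σ - 1) :=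
        Real.rpow_le_rpow_of_exponent_le hd1 (by linarith)
      have h2 := mul_le_mul_of_nonneg_left h1 (by positivity : (0 : ℝ) ≤ 2 * E.A₁₄)
      linarith
    refine case_two_exponent_contradiction' (σ := σ) (β := β) (ν := ν)
      (K₁ := 16 * E.B₁₄ / (E.κ * E.A₁₄)) (K₂ := 8 / E.κ) (by positivity) (by positivity)
      hσ1 hσ32 hβ (hν2 hσ32) fun N => ?_
    obtain ⟨D, hD, hdeglt⟩ := hC2 (D₂ + N₀ + 1 + ⌈N⌉₊)
    obtain ⟨hN₀d, hdD, hcrit, hdeg, hht⟩ := regime D (by omega)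
    obtain ⟨hd0, -, -⟩ := h17' (E.dstar mf D) (by omega)
    obtain ⟨-, -, hP⟩ := h17' D (by omega)
    have hd1 : 1 ≤ E.dstar mf D := by omega
    have hcore := E.case2_core hσ1 hβ hν hd1 hdD hd0 (hN₂ _ (by omega)) (hN₃ _ (by omega))
      (hN₄ _ (by omega)) hcrit hdeg hht hdeglt hP
    refine ⟨D, ?_, E.dstar mf D, by exact_mod_cast hd1, hcore.1, hcore.2⟩
    have : (⌈N⌉₊ : ℝ) ≤ D := by exact_mod_cast (show ⌈N⌉₊ ≤ D by omega)
    exact le_trans (Nat.le_ceil N) this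
  · -- Case 1 (`deg Z̃_D ≤ 2A (D*)^{σ-1}` for all large `D`)
    push Not at hC2
    obtain ⟨Nc, hNc⟩ := hC2
    obtain ⟨D₃, hD₃⟩ := hbig (Nc + D₂ + N₀ + 1)
    set D : ℕ := D₃ + D₂ + N₀ + 1 + Nc with hD_def
    have hdM : Nc + D₂ + N₀ + 1 ≤ E.dstar mf D := hD₃ D (by omega)
    obtain ⟨hN₀d, hdD, hcrit, hdegT', hhtT⟩ := regime D (by omega)
    set d : ℕ := E.dstar mf D with hd_def
    obtain ⟨hN₀d', hd'd, -, hdegS'', hhtS''⟩ := regime d (by omega)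
    have hdegT : ((E.pts (E.zt mf D)).card : ℝ) ≤ 2 * E.A₁₄ * (d : ℝ) ^ (σ - 1) := hNc D (by omega)
    have hdegS0 : ((E.pts (E.zt mf d)).card : ℝ) ≤ 2 * E.A₁₄ * (E.dstar mf d : ℝ) ^ (σ - 1) :=
      hNc d (by omega)
    have hd1n : 1 ≤ d := by omega
    have hd'r : (E.dstar mf d : ℝ) ≤ d := by exact_mod_cast hd'd.le
    have hd'0 : (0 : ℝ) ≤ E.dstar mf d := by positivity
    have hdegS : ((E.pts (E.zt mf d)).card : ℝ) ≤ 2 * E.A₁₄ * (d : ℝ) ^ (σ - 1) :=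
      hdegS0.trans (mul_le_mul_of_nonneg_left (Real.rpow_le_rpow hd'0 hd'r (by linarith))
        (by positivity))
    have hdegS' : ((E.pts (E.zt mf d)).card : ℝ) ≤ 2 * E.A₁₄ * (d : ℝ) ^ (2 - σ) :=
      hdegS''.trans (mul_le_mul_of_nonneg_left (Real.rpow_le_rpow hd'0 hd'r (by linarith))
        (by positivity))
    have hhtS : E.ht (E.zt mf d) ≤ 2 * E.B₁₄ * (d : ℝ) ^ (1 + β - σ) :=
      hhtS''.trans (mul_le_mul_of_nonneg_left (Real.rpow_le_rpow hd'0 hd'r (by linarith))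
        (by positivity))
    obtain ⟨hd0, hmd, hPS⟩ := h17' d (by omega)
    obtain ⟨-, -, hPT⟩ := h17' D (by omega)
    have hne : ∀ i j : ℤ, |(i : ℝ)| < ⌊(d : ℝ) ^ σ⌋₊ → |(j : ℝ)| < ⌊(d : ℝ) ^ σ⌋₊ →
        ∀ b ∈ E.pts (E.τV i (E.zt mf D)), ∀ b' ∈ E.pts (E.τV j (E.zt mf d)), b ≠ b' :=
      fun i j hi hj b hb b' hb' => E.ne_translates hd0 hmd hcrit hi hj hb hb'
    exact E.case1_core hσ1 hβ hν hd1n hdD.le (hN₁ d (by omega)) hdegT hdegS hdegT' hdegS'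
      hhtT hhtS hne hPT hPS

end EndgameData

end NguyenRoy

end Literature.NumberTheory.Transcendental

end
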